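import Literature.MathematicalPhysics.QuantumLattice.WilsonFermionBlockAveraging
import HarnessLib

/-!
# The composition law of the fermionic block renormalisation group: Dimock, *QED on the 3-torus II*,
# Appendix A LEMMA 5 (210)–(211) = Bałaban–O'Carroll–Schor, *Block RG for Euclidean fermions*,
# Lemma II.1 / (1.3) — the Gaussian kernel identity with a spectator centre and the two-step
# composition `T_{c,Q} T_{b,R} = N · T_{b',QR}`, `1/b' = 1/b + 1/c`, PROVED

statement-level skeleton of published theorems with citation tags; proofs where landed; nothing here is a claim about the Yang–Mills mass gap

**Citation header (reproduction of PUBLISHED work).**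
* J. Dimock, *Quantum electrodynamics on the 3-torus. II. The renormalization group flow*,
  arXiv:math-ph/0407063 (2004) [Dimock2004QED3TorusII]: the convention (6) p.4 L3–7, the fermionic
  multi-step identity (30) and its inductive kernel (35) p.7 L21–80 with the weights (34), and
  **Appendix A.2 LEMMA 5 (210) with its proof (211)**, p.32 L119 – p.33 L58 of the arXiv-v1 text layer
  `paper:arxiv-math-ph_0407063` (`p.NN Lnn` = PDF page ∕ text-layer line). Writer seat p11
  (literature-prover-lit-balaban-p11-g17-0), YM LIT SWEEP item (c) D13; companion of the seat's D13
  file `Dimock2011to13/QED3BlockPotentialSums.lean` (§3.1 LEMMA 1).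
* T. Bałaban, M. O'Carroll, R. Schor, *Block renormalization group for Euclidean fermions*, Commun.
  Math. Phys. **122** (1989) 233–247 [BalabanOcarrollSchor1989] (held: `paper:doi-10-1007-bf01257414`):
  (1.1)–(1.3) p.234 and **§II Lemma II.1 with its proof**, p.237 L15–41.

**The printed statements.** Dimock (6), p.4 L3–7: *"We are using the notation
`|Ψ_{k+1,L} − Q_{e_k}(A′_k)Ψ_k|² = (Ψ̄_{k+1,L} − Q_{e_k}(−A′_k)Ψ̄_k, Ψ_{k+1,L} − Q_{e_k}(A′_k)Ψ_k)`"*.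
p.7 L53–62: *"The numbers `b_k` obey `b_k = ((1 − L⁻¹)/(1 − L⁻ᵏ)) b` (34) … The formula (30) is again
proved by induction. It comes down to the Gaussian integral*
`∫ dΨ_k M⁻¹_{k+1,b} M⁻¹_{k,b_k} exp(−(b/L)|Ψ_{k+1,L} − Q_{e_k}(Q̃_kA_k)Ψ_k|²) exp(−b_k|Ψ_k − Q_k(A_{k−1,L⁻¹},…,A_{0,L⁻ᵏ})ψ_L|²)
= M⁻¹_{k+1,b_{k+1}} exp(−b_{k+1}|Ψ_{k+1} − Q_{k+1}(A_{k,L⁻¹},…,A_{0,L^{−k−1}})ψ|²)` (35)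
*which we prove in Appendix A."*  Appendix A.2, **LEMMA 5** (p.33 L1–19) = (210) (the same display with
general fields `a_j`), and its proof (p.33 L23–58): *"First shift `Ψ_k → Ψ_k + Q_k(a_{k−1,L},…,a_{0,L})ψ_L`
and `Ψ̄_k → Ψ̄_k + Q_k(−a_{k−1,L},…,−a_{0,L})ψ̄_L` and identify `Q_{k+1}(a_k,…,a_0)`. Then left side can be
written with `Φ = Ψ_{k+1} − Q_{k+1}(a_k,…,a_0)ψ` and `Φ̄ = Ψ̄_{k+1} − Q_{k+1}(−a_k,…,−a_0)ψ̄` and `A = Q̃_ka_{k,L}`: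
`∫dΨ_k M⁻¹M⁻¹ exp(−(b/L)|Φ_L − Q_{e_k}(A)Ψ_k|²) exp(−b_k(Ψ̄_k,Ψ_k))
 = const exp(−b(Φ̄,Φ)) ∫dΨ_k exp(−(b/L)(Q_{e_k}(A)ᵀΦ̄_L,Ψ_k)) exp(−(b/L)(Ψ̄_k,Q_{e_k}(−A)ᵀΦ_L))
   exp(−(Ψ̄_k,[b_k + (b/L)Q_{e_k}(−A)ᵀQ_{e_k}(A)]Ψ_k))
 = const exp(−b(Φ̄,Φ)) exp((b²/L²)(Q_{e_k}(A)ᵀΦ̄_L,[b_k + (b/L)Q_{e_k}(−A)ᵀQ_{e_k}(A)]⁻¹Q_{e_k}(−A)ᵀΦ_L))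
 = const exp(−b(Φ̄,Φ)) exp((b²/L)(Φ̄,(b_k + b/L)⁻¹Φ)) = const exp(−b_{k+1}(Φ̄,Φ))` (211).
*Here we have used `Q_{e_k}(A)Q_{e_k}(−A)ᵀ = I` and `b_{k+1} = bb_k/(b_k + bL⁻¹)`. Since the left side
integrates to one, the right side integrates to one which means the constant must be `M⁻¹_{k+1,b_{k+1}}`
and we have the result."*
Bałaban–O'Carroll–Schor, p.237 L15–18: *"Throughout we use the easily derived relation `Q_kQ_k* = I`,
`∫dφ̄dφ e^{(φ̄,Aφ)} = det A`, the translation formula `∫f(φ̄ + χ̄, φ + χ)dφ̄dφ = ∫f(φ̄,φ)dφ̄dφ`, and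
`∫dφ̄dφ exp[(φ̄,Aφ) + (J̄,φ) + (φ̄,J)] = det A e^{−(J̄,A⁻¹J)}`"*; L22–35: *"The composition law is given by
**Lemma II.1.** `T^{L^kε}_{a,L} T^{ε}_{a_k,L^k} = T^{ε}_{a_{k+1},L^{k+1}}` … where `(1/a_{k+1}) = (L⁻¹/a_k) + 1/a`
with solution `a_k = a(1 − L⁻¹)/(1 − L⁻ᵏ)`"*; L39–41: *"Proof of Lemma II.1. Using `ψ̄,ψ` (`φ̄,φ`) for the
integration variables of `T^{L^kε}_{a,L}` (`T^ε_{a_k,L^k}`) and the translation formula … do the `ψ`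
integral, use `Q_kQ_k* = I`, and equate the coefficients of the quadratic form on both sides."*
The transformation itself is (1.1) p.234: `(T_{a,L}ρ)(χ̄,χ) = N ∫ exp[−a(Lε)⁻¹(χ̄ − φ̄Q⁺, χ − Qφ)] ρ(φ̄,φ) dφ̄dφ`
(the tree's `fermionBlockRG`, `WilsonFermionBlockAveraging.lean`, without `N`).

**What is here (kernel-checked, zero `sorry`; the two tree files `WilsonFermionBlockAveraging.lean`
(l.98) and `BlockFermionRG.lean` (§ "What is NOT here") record BOS's composition law (1.3) ∕ Lemma II.1
as not formalised — this file supplies it).**  Everything is stated in ONE ambient Grassmann algebra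
`Λ(J) = GrassmannAlgebra R J` (any finite linear order `J`, any commutative `ℚ`-algebra `R`) in which
the INTEGRATED fermions `Ψ̄_k(i) = θ_{e(inl i)}`, `Ψ_k(j) = θ_{e(inr j)}` (`psiBarOf`, `psiOf`) are
placed by an order embedding `e : m ⊕ₗ m ↪o J`, and every other field — the block field `Φ̄_y, Φ_y`
(`y : n`) and the centre `η̄_i, η_i` — is an arbitrary degree-one SPECTATOR `ι(v)`, `v : J → R`
vanishing on the range of `e` (so `Φ = Ψ_{k+1,L} − Q_{k+1}ψ` of (211), mixing two further fermion
families, is covered).  `Q : Matrix n m R` is Dimock's `Q_{e_k}(A)` and `Q̄ : Matrix m n R` his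
`Q_{e_k}(−A)ᵀ` (BOS's `Q`, `Q⁺`); the Riemann-sum weights and the factor `L⁻¹` of `b/L` are absorbed
into the scalar `c` (as in the tree's `fermionBlockRG`; see "Design" below).
* §1 **«use `Q(A)Q(−A)ᵀ = I`» — the matrix algebra of (211)** (any commutative ring): for `QQ̄ = 1` the
  operator `P = Q̄Q` is idempotent (`conjAvg_mul_avg_mul_self`), hence
  `(b·1 + cQ̄Q)((b+c)·1 − cQ̄Q) = b(b+c)·1` (`scalarFluctuationOp_mul`), `(b·1 + cQ̄Q)⁻¹` in closed form
  (`inv_scalarFluctuationOp`), **`Q(b·1 + cQ̄Q)⁻¹Q̄ = (b+c)⁻¹·1`** (`avg_mul_inv_scalarFluctuationOp_mul_conjAvg`,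
  the third equality of (211)), the tree's block Dirac operator of a scalar action
  **`blockDirac c Q Q̄ (b·1) = (cb∕(b+c))·1`** (`blockDirac_scalar` — Dimock's `b_{k+1} = bb_k/(b_k + bL⁻¹)`,
  BOS's `1/a_{k+1} = L⁻¹/a_k + 1/a`), the determinant of the fluctuation operator by the
  Weinstein–Aronszajn identity, `det(b·1 + cQ̄Q) = b^{|m|}(1 + b⁻¹c)^{|n|} = b^{|m|−|n|}(b+c)^{|n|}`
  (`det_scalarFluctuationOp`, `det_scalarFluctuationOp_mul_pow`, `det_scalarFluctuationOp_eq`, with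
  `|n| ≤ |m|` from `QQ̄ = 1`, `card_le_card_of_avg_mul_conjAvg`), and the closed form (34) of the weight
  recursion (`fermionWeight_one`, `fermionWeight_succ`).
* §2 **The Gaussian kernel identity, general action `D`** (no `QQ̄ = 1` needed):
  `∫dθ_s e^{−c Σ_y (Φ̄_y − (Ψ̄Q̄)_y)(Φ_y − (QΨ)_y)} e^{−Σ_{ij} D_{ij}(Ψ̄_i − η̄_i)(Ψ_j − η_j)}
   = ε det(−F) · e^{−Σ_{yy'} (D₁)_{yy'} (Φ̄ − η̄Q̄)_y (Φ − Qη)_{y'}}`,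
  `F = D + cQ̄Q` (`fluctuationOp`), `D₁ = c·1 − c²QF⁻¹Q̄` (`blockDirac`), `ε = (−1)^{|m|(|m|−1)/2}` the
  orientation sign of the tree's Berezin integral — `berezinOn_blockWeight_mul_gaussian` (η = 0) and
  **`berezinOn_blockWeight_mul_centredGaussian`** (general centre; Dimock's *"First shift … and
  identify"* is the tree's translation invariance `IsSpectatorShift.berezinOn_map`; *"exp of the
  completed square"* is the tree's Gaussian Berezin integral with sources
  `berezinOn_grassmannExp_quadratic_add_sources` = BOS's third formula of p.237).
* §3 **LEMMA 5 ∕ (35) ∕ (210) as printed (scalar action, `QQ̄ = 1`)**: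
  `∫dθ_s e^{−c|Φ − QΨ|²} e^{−b|Ψ − η|²} = ε det(−(b·1 + cQ̄Q)) · e^{−(cb∕(b+c)) |Φ − Qη|²}` in the notation (6)
  — **`berezinOn_blockWeight_mul_centredScalarGaussian`** (`b, b + c` units); the constant is explicit
  and evaluated in §1 (the paper fixes it instead by *"the left side integrates to one"*, which in the
  tree is `BlockFermionRG.berezin_fermionBlockRG`).
* §4 **The composition law, BOS Lemma II.1 ∕ (1.3), Dimock (30) one step**: for a second fermion family
  `φ̄, φ` placed by `f : p ⊕ₗ p ↪o J` disjointly from `e`, block entries `Φ̄, Φ` off both, and ANY density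
  `ρ` not involving `Ψ̄_k, Ψ_k` (a spectator of `s_e`; it may involve `φ` and anything else):
  `∫dθ_{s_e} e^{−c|Φ − QΨ|²} ∫dθ_{s_f} e^{−b|Ψ − Rφ|²} ρ = ε det(−(b·1 + cQ̄Q)) · ∫dθ_{s_f} e^{−(cb∕(b+c))|Φ − QRφ|²} ρ`
  — **`berezinOn_blockWeight_mul_berezinOn_blockWeight_mul`** (*"do the `ψ` integral, use `QQ* = I`"*;
  Fubini for the two disjoint blocks is the tree's `berezinOn_berezinOn`, made sign-free by
  `berezinOn_comm_of_even` since a fermion block `m ⊕ₗ m` has even size).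
* §5 **Corollary in the tree's two-algebra framework**: `fermionBlockRG c Q Q̄ (e^{−bψ̄ψ}) =
  ε det(−(b·1 + cQ̄Q)) • e^{−(cb∕(b+c)) χ̄χ}` (`fermionBlockRG_grassmannExp_scalar`, from the tree's
  `fermionBlockRG_grassmannExp_quadratic` and §1).
* §6 (v1.1) **BOS Lemma II.1 ∕ (1.3) for the tree's TRANSFORMATIONS, on every density**:
  `fermionBlockRG c Q Q̄ (fermionBlockRG b R R̄ ρ) = ε det(−(b·1 + cQ̄Q)) • fermionBlockRG (cb∕(b+c)) (QR) (R̄Q̄) ρ`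
  for all `ρ ∈ Λ(φ̄,φ)` (`QQ̄ = 1`; `b`, `b + c` units) — **`fermionBlockRG_fermionBlockRG`**; obtained by
  reading the three transformations in the three-family algebra `Λ((n⊕n) ⊕ ((m⊕m) ⊕ (p⊕p)))`
  (`map_extendByZero_fermionBlockRG`: the tree's `fermionBlockRG` computed inside any ambient algebra;
  order embeddings `frontLex`, `skipMiddleLex`), applying §4, and pulling back along the injective
  embedding of `Λ(χ̄,χ)` (`map_extendByZero_injective`).
* §7 (v1.2) **BOS Lemma II.1 "in iterated form" ∕ Dimock (30), the `k`-fold tower**: along a tower of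
  fermion lattices `𝓘 0, 𝓘 1, …` with one-step data `Q_j, Q̄_j` (`Q_jQ̄_j = 1`) and weights `c_j`, the
  composite averages `Qacc`, `Qbacc` (again `Q_kQ̄_k = 1`, `Qacc_mul_Qbacc`), the accumulated weight
  `bacc` (`1/bacc_{k+1} = 1/bacc_k + 1/c_{k+1}`) and constant `accConst`, and **`towerT_succ`**:
  `T_{c_k} ⋯ T_{c_0} ρ = accConst k • T_{bacc k, Qacc (k+1), Qbacc (k+1)} ρ` for every density `ρ`
  (induction on `k`, each step `fermionBlockRG_fermionBlockRG`).

**Design ∕ honest scope.** (i) As in the tree's `fermionBlockRG`, inner products are plain finite sums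
and the lattice-spacing weights of (6)∕(10), the fermion field scaling `σ_L` and the factor `L⁻¹` are
absorbed into the scalars `b, c` (`c` = Dimock's `b/L` times the Riemann weight); with this dictionary
(211)'s `b_{k+1} = bb_k/(b_k + bL⁻¹)` is `blockDirac_scalar`'s `cb_k∕(b_k + c)`.  (ii) The normalising
constants `M_{k,b}` of (8) are not carried: the constant is given explicitly as `ε det(−F)` and in closed
form by §1; Dimock's determination of it (*"integrates to one"*) is the tree's
`BlockFermionRG.berezin_fermionBlockRG` ((1.2) of BOS) and is not re-proved here.  (iii) The gauge-field
dependence of `Q = Q_{e_k}(Q̃_kA_k)` is a hypothesis-free parameter here (any matrices with `QQ̄ = 1`; for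
the covariant averages this identity is Dimock's *"Q_{e_k}(A)Q_{e_k}(−A)ᵀ = I"*, BOS's *"Q_kQ_k* = I"*,
an instance being the tree's torus block averages); LEMMA 6 (214) (the explicit composite `Q_k`) and the
bosonic LEMMA 4 (206) (= the tree's `Dimock2011to13/BlockTransformComposition.blockT_blockT`) are not
repeated.  (iv) The `k`-fold statement (30) is the `k`-fold iteration of §4 ∕ §6: its Gaussian part
(composite averages and weights) is §7; the accompanying Dirac-operator recursion `D_k` (BOS Lemma
II.2–II.3, Dimock (38)–(40)) is the tree's one-step `fermionBlockRG_grassmannExp_quadratic` ∕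
`blockDirac` and is not iterated here.
(v1.0 p330616 = §§1–5, seat p11 gen 17; v1.1 p331150 = the same text with §6 appended; v1.2 = the
same with §7 appended and this docstring extended — no declaration changed or removed.)

Mathlib: `Matrix.det_one_add_mul_comm` (Weinstein–Aronszajn), `Matrix.rank_mul_le_left`,
`Matrix.inv_eq_right_inv`, `IsNilpotent.exp`, `module`; the tree: `GrassmannIntegralPartial(Shift)`
(`berezinOn`, spectators, `IsSpectatorShift`, `berezinOn_berezinOn`), `GrassmannGaussianSources`
(`berezinOn_grassmannExp_quadratic_add_sources`), `WilsonFermionBlockAveraging` (`fluctuationOp`,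
`blockDirac`, `fermionBlockRG`, `fermionBlockRG_grassmannExp_quadratic`).
-/

noncomputable section

open Finset Matrix

namespace Literature.MathematicalPhysics.QuantumLattice

section QLatticeAQFT

namespace FermionBlockRG

open GrassmannAlgebra ExteriorAlgebra

/-! ### §1 «use `Q(A)Q(−A)ᵀ = I`»: the matrix algebra of (211) -/

section MatrixAlgebra

variable {R : Type*} [CommRing R] {m n : Type*} [Fintype m] [Fintype n] [DecidableEq m]
  [DecidableEq n]

omit [DecidableEq m] in
/-- For averaging data with `QQ̄ = 1` (Dimock: `Q_{e_k}(A)Q_{e_k}(−A)ᵀ = I`; BOS: `Q_kQ_k* = I`) the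
fine-lattice operator `P = Q̄Q` is idempotent. [cite: Dimock2004QED3TorusII, App. A (211)] -/
theorem conjAvg_mul_avg_mul_self (Q : Matrix n m R) (Qb : Matrix m n R) (h : Q * Qb = 1) :
    Qb * Q * (Qb * Q) = Qb * Q := by
  rw [Matrix.mul_assoc, ← Matrix.mul_assoc Q, h, Matrix.one_mul]

omit [Fintype m] [DecidableEq n] in
/-- The fluctuation operator of a SCALAR fine action `bΨ̄Ψ` is `b·1 + cQ̄Q` — Dimock's
`[b_k + (b/L)Q_{e_k}(−A)ᵀQ_{e_k}(A)]` of (211). [cite: Dimock2004QED3TorusII, App. A (211)] -/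
theorem fluctuationOp_scalar (c : R) (Q : Matrix n m R) (Qb : Matrix m n R) (b : R) :
    fluctuationOp c Q Qb (b • (1 : Matrix m m R)) = b • (1 : Matrix m m R) + c • (Qb * Q) := rfl

/-- **`(b·1 + cQ̄Q)((b+c)·1 − cQ̄Q) = b(b+c)·1`** when `QQ̄ = 1` (the idempotent `Q̄Q` splits the
fluctuation operator into the scalars `b` and `b + c`). [cite: Dimock2004QED3TorusII, App. A (211)] -/
theorem scalarFluctuationOp_mul (Q : Matrix n m R) (Qb : Matrix m n R) (h : Q * Qb = 1) (b c : R) :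
    (b • (1 : Matrix m m R) + c • (Qb * Q)) * ((b + c) • (1 : Matrix m m R) - c • (Qb * Q)) =
      (b * (b + c)) • (1 : Matrix m m R) := by
  have hPP := conjAvg_mul_avg_mul_self Q Qb h
  rw [Matrix.add_mul, Matrix.mul_sub, Matrix.mul_sub]
  simp only [Matrix.smul_mul, Matrix.mul_smul, Matrix.one_mul, Matrix.mul_one, hPP, smul_smul]
  module

/-- Hence `det(b·1 + cQ̄Q)` is a unit as soon as `b` and `b + c` are (no field needed).
[cite: Dimock2004QED3TorusII, App. A (211)] -/
theorem isUnit_det_scalarFluctuationOp (Q : Matrix n m R) (Qb : Matrix m n R) (h : Q * Qb = 1)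
    {b c : R} (hb : IsUnit b) (hbc : IsUnit (b + c)) :
    IsUnit (fluctuationOp c Q Qb (b • (1 : Matrix m m R))).det := by
  have h1 := congrArg Matrix.det (scalarFluctuationOp_mul Q Qb h b c)
  rw [Matrix.det_mul, Matrix.det_smul, Matrix.det_one, mul_one] at h1
  have h2 : IsUnit ((fluctuationOp c Q Qb (b • (1 : Matrix m m R))).det *
      ((b + c) • (1 : Matrix m m R) - c • (Qb * Q)).det) := by
    rw [fluctuationOp, h1]; exact (hb.mul hbc).pow _
  exact isUnit_of_mul_isUnit_left h2

/-- The inverse of the scalar fluctuation operator in closed form,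
`(b·1 + cQ̄Q)⁻¹ = (b(b+c))⁻¹((b+c)·1 − cQ̄Q)` — Dimock's `[b_k + (b/L)Q(−A)ᵀQ(A)]⁻¹` of (211).
[cite: Dimock2004QED3TorusII, App. A (211)] -/
theorem inv_scalarFluctuationOp (Q : Matrix n m R) (Qb : Matrix m n R) (h : Q * Qb = 1) {b c : R}
    (hu : IsUnit (b * (b + c))) :
    (b • (1 : Matrix m m R) + c • (Qb * Q))⁻¹ =
      Ring.inverse (b * (b + c)) • ((b + c) • (1 : Matrix m m R) - c • (Qb * Q)) := by
  refine Matrix.inv_eq_right_inv ?_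
  rw [Matrix.mul_smul, scalarFluctuationOp_mul Q Qb h, smul_smul, Ring.inverse_mul_cancel _ hu,
    one_smul]

/-- **The third equality of (211)**: `Q(A)[b_k + cQ(−A)ᵀQ(A)]⁻¹Q(−A)ᵀ = (b_k + c)⁻¹`, i.e.
`Q(b·1 + cQ̄Q)⁻¹Q̄ = (b+c)⁻¹·1` for `QQ̄ = 1` (*"Here we have used `Q_{e_k}(A)Q_{e_k}(−A)ᵀ = I`"*).
[cite: Dimock2004QED3TorusII, App. A (211)] -/
theorem avg_mul_inv_scalarFluctuationOp_mul_conjAvg (Q : Matrix n m R) (Qb : Matrix m n R)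
    (h : Q * Qb = 1) {b c : R} (hb : IsUnit b) (hbc : IsUnit (b + c)) :
    Q * (b • (1 : Matrix m m R) + c • (Qb * Q))⁻¹ * Qb =
      Ring.inverse (b + c) • (1 : Matrix n n R) := by
  rw [inv_scalarFluctuationOp Q Qb h (hb.mul hbc), Matrix.mul_smul, Matrix.smul_mul, Matrix.mul_sub,
    Matrix.sub_mul, Matrix.mul_smul, Matrix.smul_mul, Matrix.mul_one, h, Matrix.mul_smul,
    Matrix.smul_mul, ← Matrix.mul_assoc, h, Matrix.one_mul, h, ← sub_smul, smul_smul]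
  congr 1
  obtain ⟨u, rfl⟩ := hb
  obtain ⟨v, hv⟩ := hbc
  rw [show (u : R) + c - c = u by abel, ← hv, ← Units.val_mul, Ring.inverse_unit, Ring.inverse_unit,
    _root_.mul_inv_rev, Units.val_mul, mul_assoc, Units.inv_mul, mul_one]

/-- **The block Dirac operator of a scalar action is scalar**: for `QQ̄ = 1` and `b, b + c` units,
`blockDirac c Q Q̄ (b·1) = c·1 − c²Q(b·1 + cQ̄Q)⁻¹Q̄ = (cb∕(b+c))·1` — the last two equalities of (211),
i.e. Dimock's weight recursion `b_{k+1} = bb_k/(b_k + bL⁻¹)` and BOS's `1/a_{k+1} = L⁻¹/a_k + 1/a`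
(*"equate the coefficients of the quadratic form on both sides"*). [cite: Dimock2004QED3TorusII, App. A Lemma 5 (211)] -/
theorem blockDirac_scalar (Q : Matrix n m R) (Qb : Matrix m n R) (h : Q * Qb = 1) {b c : R}
    (hb : IsUnit b) (hbc : IsUnit (b + c)) :
    blockDirac c Q Qb (b • (1 : Matrix m m R)) =
      (c * b * Ring.inverse (b + c)) • (1 : Matrix n n R) := by
  rw [blockDirac, fluctuationOp, avg_mul_inv_scalarFluctuationOp_mul_conjAvg Q Qb h hb hbc, smul_smul,
    ← sub_smul]
  congr 1
  obtain ⟨v, hv⟩ := hbc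
  have hb' : b = (v : R) - c := eq_sub_of_add_eq hv.symm
  rw [← hv, Ring.inverse_unit, hb', mul_sub, sub_mul, mul_assoc c (v : R), Units.mul_inv, mul_one]
  ring

omit [DecidableEq m] in
/-- `QQ̄ = 1_n` forces `|n| ≤ |m|` (rank count; any nontrivial commutative ring). [folklore] -/
private theorem card_le_card_of_avg_mul_conjAvg [Nontrivial R] (Q : Matrix n m R) (Qb : Matrix m n R)
    (h : Q * Qb = 1) : Fintype.card n ≤ Fintype.card m := by
  have h1 : (Q * Qb).rank = Fintype.card n := by rw [h, Matrix.rank_one]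
  rw [← h1]
  exact (Matrix.rank_mul_le_left Q Qb).trans (Matrix.rank_le_card_width Q)

/-- **The determinant of the scalar fluctuation operator** (the constant of LEMMA 5 ∕ of BOS
Lemma II.1, `∫dφ̄dφ e^{(φ̄,Aφ)} = det A` with `A = −(b·1 + cQ̄Q)`), by the Weinstein–Aronszajn identity
`det(1 + XY) = det(1 + YX)` and `QQ̄ = 1`: `det(b·1 + cQ̄Q) = b^{|m|}(1 + b⁻¹c)^{|n|}`.
[cite: BalabanOcarrollSchor1989, §II Lemma II.1] -/
theorem det_scalarFluctuationOp (Q : Matrix n m R) (Qb : Matrix m n R) (h : Q * Qb = 1) {b : R}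
    (c : R) (hb : IsUnit b) :
    (b • (1 : Matrix m m R) + c • (Qb * Q)).det =
      b ^ Fintype.card m * (1 + Ring.inverse b * c) ^ Fintype.card n := by
  have e : b • (1 : Matrix m m R) + c • (Qb * Q) =
      b • ((1 : Matrix m m R) + Qb * ((Ring.inverse b * c) • Q)) := by
    rw [smul_add, Matrix.mul_smul, smul_smul, ← mul_assoc, Ring.mul_inverse_cancel _ hb, one_mul]
  have e2 : (1 : Matrix n n R) + (Ring.inverse b * c) • Q * Qb = (1 + Ring.inverse b * c) • 1 := by
    rw [Matrix.smul_mul, h, add_smul, one_smul]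
  rw [e, Matrix.det_smul, Matrix.det_one_add_mul_comm, e2, Matrix.det_smul, Matrix.det_one, mul_one]

/-- Unit-free form of the determinant: `det(b·1 + cQ̄Q) · b^{|n|} = b^{|m|}(b+c)^{|n|}`.
[cite: BalabanOcarrollSchor1989, §II Lemma II.1] -/
theorem det_scalarFluctuationOp_mul_pow (Q : Matrix n m R) (Qb : Matrix m n R) (h : Q * Qb = 1)
    {b : R} (c : R) (hb : IsUnit b) :
    (b • (1 : Matrix m m R) + c • (Qb * Q)).det * b ^ Fintype.card n =
      b ^ Fintype.card m * (b + c) ^ Fintype.card n := by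
  rw [det_scalarFluctuationOp Q Qb h c hb, mul_assoc, ← mul_pow, add_mul, one_mul, mul_assoc,
    mul_comm c b, ← mul_assoc, Ring.inverse_mul_cancel _ hb, one_mul]

/-- Closed form **`det(b·1 + cQ̄Q) = b^{|m|−|n|}(b+c)^{|n|}`** (`|n| ≤ |m|` by
`card_le_card_of_avg_mul_conjAvg`): per block site the middle Gaussian weight `b` is traded for `b + c`.
[cite: BalabanOcarrollSchor1989, §II Lemma II.1] -/
theorem det_scalarFluctuationOp_eq [Nontrivial R] (Q : Matrix n m R) (Qb : Matrix m n R)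
    (h : Q * Qb = 1) {b : R} (c : R) (hb : IsUnit b) :
    (b • (1 : Matrix m m R) + c • (Qb * Q)).det =
      b ^ (Fintype.card m - Fintype.card n) * (b + c) ^ Fintype.card n := by
  have hle := card_le_card_of_avg_mul_conjAvg Q Qb h
  have key := det_scalarFluctuationOp_mul_pow Q Qb h c hb
  obtain ⟨u, rfl⟩ := hb
  have hsplit : (u : R) ^ Fintype.card m =
      (u : R) ^ (Fintype.card m - Fintype.card n) * (u : R) ^ Fintype.card n := by
    rw [← pow_add, Nat.sub_add_cancel hle]
  rw [hsplit, mul_right_comm] at key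
  exact (Units.isUnit (u ^ Fintype.card n)).mul_left_injective
    (by simpa [Units.val_pow_eq_pow_val] using key)

end MatrixAlgebra

/-! ### §1b The closed form (34) of the weight recursion -/

section Weights

variable {𝕜 : Type*} [Field 𝕜]

/-- Dimock's fermionic multi-step Gaussian weight (34): `b_k = ((1 − L⁻¹)/(1 − L⁻ᵏ)) b`, written with
`r = L⁻¹` (BOS Lemma II.1: `a_k = a(1 − L⁻¹)/(1 − L⁻ᵏ)`). [cite: Dimock2004QED3TorusII, §1.3 (34)] -/
def fermionWeight (b r : 𝕜) (k : ℕ) : 𝕜 := (1 - r) / (1 - r ^ k) * b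

/-- `b₁ = b`: one step carries the bare weight. [cite: Dimock2004QED3TorusII, §1.3 (34)] -/
theorem fermionWeight_one (b r : 𝕜) (hr : r ≠ 1) : fermionWeight b r 1 = b := by
  rw [fermionWeight, pow_one, div_self (sub_ne_zero.2 (Ne.symm hr)), one_mul]

/-- **(34) solves the recursion of (211)**: `b_{k+1} = b·b_k/(b_k + b·r)` (`r = L⁻¹`), provided the
denominators `1 − rᵏ`, `1 − r^{k+1}` and `b` are non-zero. [cite: Dimock2004QED3TorusII, App. A (211)] -/
theorem fermionWeight_succ (b r : 𝕜) (k : ℕ) (hb : b ≠ 0) (hk : 1 - r ^ k ≠ 0)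
    (hk1 : 1 - r ^ (k + 1) ≠ 0) :
    fermionWeight b r (k + 1) = b * fermionWeight b r k / (fermionWeight b r k + b * r) := by
  have hden : fermionWeight b r k + b * r ≠ 0 := by
    rw [fermionWeight, div_mul_eq_mul_div, div_add' _ _ _ hk]
    refine div_ne_zero ?_ hk
    have : (1 - r) * b + b * r * (1 - r ^ k) = b * (1 - r ^ (k + 1)) := by ring
    rw [this]; exact mul_ne_zero hb hk1
  rw [eq_div_iff hden, fermionWeight, fermionWeight]
  field_simp
  ring

end Weights

/-! ### §2 The Gaussian kernel identity in an ambient Grassmann algebra -/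

section Kernel

variable (R : Type*) [CommRing R]
variable {m n : Type*} [LinearOrder m] [Fintype m] [Fintype n]
variable {J : Type*} [LinearOrder J] [Fintype J]

/-- The integrated conjugate fermion `Ψ̄_k(i) = θ_{e(inl i)}` placed in the ambient algebra `Λ(J)` by the
order embedding `e`. [folklore] -/
abbrev psiBarOf (e : m ⊕ₗ m ↪o J) (i : m) : GrassmannAlgebra R J := gen R (e (toLex (Sum.inl i)))

/-- The integrated fermion `Ψ_k(j) = θ_{e(inr j)}`. [folklore] -/
abbrev psiOf (e : m ⊕ₗ m ↪o J) (j : m) : GrassmannAlgebra R J := gen R (e (toLex (Sum.inr j)))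

/-- The source vector of `Ψ_k(j)` produced by expanding `c(Φ̄ − Ψ̄Q̄)(Φ − QΨ)`: `c Σ_y Q_{yj} Φ̄_y`
(Dimock: `(b/L)Q_{e_k}(A)ᵀΦ̄_L`; BOS: `J̄`). [cite: Dimock2004QED3TorusII, App. A (211)] -/
def srcBarVec (c : R) (Q : Matrix n m R) (ab : n → J → R) (j : m) : J → R := ∑ y, (c * Q y j) • ab y

/-- The source vector of `Ψ̄_k(i)`: `c Σ_y Q̄_{iy} Φ_y` (Dimock: `(b/L)Q_{e_k}(−A)ᵀΦ_L`; BOS: `J`).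
[cite: Dimock2004QED3TorusII, App. A (211)] -/
def srcVec (c : R) (Qb : Matrix m n R) (a : n → J → R) (i : m) : J → R := ∑ y, (c * Qb i y) • a y

omit [Fintype m] [LinearOrder m] [LinearOrder J] [Fintype J] in
/-- `ι(J̄_j) = c Σ_y Q_{yj} Φ̄_y`. [folklore] -/
theorem ι_srcBarVec (c : R) (Q : Matrix n m R) (ab : n → J → R) (j : m) :
    ι R (srcBarVec R c Q ab j) = ∑ y, (c * Q y j) • ι R (ab y) := by
  simp only [srcBarVec, map_sum, map_smul]

omit [Fintype m] [LinearOrder m] [LinearOrder J] [Fintype J] in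
/-- `ι(J_i) = c Σ_y Q̄_{iy} Φ_y`. [folklore] -/
theorem ι_srcVec (c : R) (Qb : Matrix m n R) (a : n → J → R) (i : m) :
    ι R (srcVec R c Qb a i) = ∑ y, (c * Qb i y) • ι R (a y) := by
  simp only [srcVec, map_sum, map_smul]

omit [Fintype m] [Fintype J] in
/-- The sources are spectators: they vanish on the integrated indices when the block field does.
[folklore] -/
private theorem srcBarVec_apply_of_forall (c : R) (Q : Matrix n m R) {ab : n → J → R} (e : m ⊕ₗ m ↪o J)
    (hab : ∀ y k, ab y (e k) = 0) (j : m) (k : m ⊕ₗ m) : srcBarVec R c Q ab j (e k) = 0 := by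
  simp only [srcBarVec, Finset.sum_apply, Pi.smul_apply, hab, smul_zero, Finset.sum_const_zero]

omit [Fintype m] [Fintype J] in
/-- The sources are spectators. [folklore] -/
private theorem srcVec_apply_of_forall (c : R) (Qb : Matrix m n R) {a : n → J → R} (e : m ⊕ₗ m ↪o J)
    (ha : ∀ y k, a y (e k) = 0) (i : m) (k : m ⊕ₗ m) : srcVec R c Qb a i (e k) = 0 := by
  simp only [srcVec, Finset.sum_apply, Pi.smul_apply, ha, smul_zero, Finset.sum_const_zero]

omit [Fintype J] in
/-- The fine quadratic action placed in the ambient algebra: `e_*(Ψ̄BΨ) = Σ B_{ij} Ψ̄_k(i)Ψ_k(j)`.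
[folklore] -/
private theorem map_extendByZero_quadratic_eq_sum (e : m ⊕ₗ m ↪o J) (B : Matrix m m R) :
    ExteriorAlgebra.map (Function.ExtendByZero.linearMap R e) (quadratic R B) =
      ∑ i, ∑ j, B i j • (psiBarOf R e i * psiOf R e j) := by
  simp only [quadratic, map_sum, map_smul, map_mul, psiBar, psi, map_extendByZero_gen']

omit [Fintype n] [Fintype J] in
/-- The defect `Φ̄_y − (Ψ̄Q̄)_y` is the degree-one element of ONE vector. [folklore] -/
theorem ι_sub_sum_smul_single_inl (e : m ⊕ₗ m ↪o J) (Qb : Matrix m n R) (ab : n → J → R) (y : n) :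
    ι R (ab y - ∑ i, Qb i y • (Pi.single (e (toLex (Sum.inl i))) 1 : J → R)) =
      ι R (ab y) - ∑ i, Qb i y • psiBarOf R e i := by
  simp only [map_sub, map_sum, map_smul, psiBarOf, gen]

omit [Fintype n] [Fintype J] in
/-- The defect `Φ_y − (QΨ)_y` is the degree-one element of ONE vector. [folklore] -/
theorem ι_sub_sum_smul_single_inr (e : m ⊕ₗ m ↪o J) (Q : Matrix n m R) (a : n → J → R) (y : n) :
    ι R (a y - ∑ j, Q y j • (Pi.single (e (toLex (Sum.inr j))) 1 : J → R)) =
      ι R (a y) - ∑ j, Q y j • psiOf R e j := by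
  simp only [map_sub, map_sum, map_smul, psiOf, gen]

omit [Fintype J] in
/-- The block-spin exponent `−c Σ_y (Φ̄_y − (Ψ̄Q̄)_y)(Φ_y − (QΨ)_y)` of the Gaussian RGT weight
(BOS (1.1): `exp[−a(Lε)⁻¹(χ̄ − φ̄Q⁺, χ − Qφ)]`; Dimock (6)) is nilpotent — a sum of products of two
degree-one elements. [cite: BalabanOcarrollSchor1989, §I (1.1)] -/
theorem isNilpotent_blockExponent (e : m ⊕ₗ m ↪o J) (c : R) (Q : Matrix n m R) (Qb : Matrix m n R)
    (ab a : n → J → R) :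
    IsNilpotent (-(c • ∑ y, (ι R (ab y) - ∑ i, Qb i y • psiBarOf R e i) *
      (ι R (a y) - ∑ j, Q y j • psiOf R e j))) := by
  simp only [← ι_sub_sum_smul_single_inl, ← ι_sub_sum_smul_single_inr]
  refine IsNilpotent.neg (IsNilpotent.smul (Commute.isNilpotent_sum (fun y _ => ⟨2, ?_⟩)
    fun y y' _ _ => commute_ι_mul_ι _ _ _) c)
  rw [pow_two]; exact ι_mul_ι_mul_self _ _

omit [Fintype J] in
/-- The block-spin exponent of the RGT weight (BOS (1.1); Dimock (6)) is central (even).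
[cite: BalabanOcarrollSchor1989, §I (1.1)] -/
theorem commute_blockExponent (e : m ⊕ₗ m ↪o J) (c : R) (Q : Matrix n m R) (Qb : Matrix m n R)
    (ab a : n → J → R) (z : GrassmannAlgebra R J) :
    Commute (-(c • ∑ y, (ι R (ab y) - ∑ i, Qb i y • psiBarOf R e i) *
      (ι R (a y) - ∑ j, Q y j • psiOf R e j))) z := by
  simp only [← ι_sub_sum_smul_single_inl, ← ι_sub_sum_smul_single_inr]
  exact (Commute.smul_left (Commute.sum_left _ _ _ fun y _ => commute_ι_mul_ι _ _ z) c).neg_left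

/-- The Gaussian RGT weight `exp(−cΣ_y(Φ̄_y − (Ψ̄Q̄)_y)(Φ_y − (QΨ)_y))` (BOS (1.1); Dimock (6)) with
block field `Φ̄ = ι(ab)`, `Φ = ι(a)` supported off `t` is a spectator for any block `t` of variables
avoided by the integrated family as well (BOS p.237: the outer weight passes through the inner
integral). [cite: BalabanOcarrollSchor1989, §I (1.1)] -/
theorem grassmannExp_blockExponent_mem_spectatorSubalgebra [Algebra ℚ R] (e : m ⊕ₗ m ↪o J) (c : R)
    (Q : Matrix n m R) (Qb : Matrix m n R) (ab a : n → J → R) {t : Finset J}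
    (het : ∀ k, e k ∉ t) (hab : ∀ y, ∀ x ∈ t, ab y x = 0) (ha : ∀ y, ∀ x ∈ t, a y x = 0) :
    grassmannExp (-(c • ∑ y, (ι R (ab y) - ∑ i, Qb i y • psiBarOf R e i) *
      (ι R (a y) - ∑ j, Q y j • psiOf R e j))) ∈ spectatorSubalgebra R t := by
  refine exp_mem_of_mem ?_ (isNilpotent_blockExponent R e c Q Qb ab a)
  simp only [← ι_sub_sum_smul_single_inl, ← ι_sub_sum_smul_single_inr]
  refine Subalgebra.neg_mem _ (Subalgebra.smul_mem _ (Subalgebra.sum_mem _ fun y _ =>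
    Subalgebra.mul_mem _ (ι_mem_spectatorSubalgebra R fun x hx => ?_)
      (ι_mem_spectatorSubalgebra R fun x hx => ?_)) _)
  · have h1 : ∀ i, (Pi.single (e (toLex (Sum.inl i))) (1 : R) : J → R) x = 0 := fun i =>
      Pi.single_eq_of_ne (fun h : x = e _ => het _ (h ▸ hx)) _
    simp only [Pi.sub_apply, Finset.sum_apply, Pi.smul_apply, h1, smul_zero, Finset.sum_const_zero,
      sub_zero, hab y x hx]
  · have h1 : ∀ j, (Pi.single (e (toLex (Sum.inr j))) (1 : R) : J → R) x = 0 := fun j =>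
      Pi.single_eq_of_ne (fun h : x = e _ => het _ (h ▸ hx)) _
    simp only [Pi.sub_apply, Finset.sum_apply, Pi.smul_apply, h1, smul_zero, Finset.sum_const_zero,
      sub_zero, ha y x hx]

omit [Fintype J] in
/-- **Expansion of the exponent into the normal form of the Gaussian integral with sources** (the
first equality of (211); BOS: *"equate the coefficients of the quadratic form"*):
`−c Σ_y (Φ̄_y − (Ψ̄Q̄)_y)(Φ_y − (QΨ)_y) − Ψ̄DΨ = e_*(Ψ̄(−F)Ψ) + Σ_j (J̄_jΨ_j + Ψ̄_jJ_j) − cΦ̄Φ`,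
`F = D + cQ̄Q`. [cite: Dimock2004QED3TorusII, App. A (211)] -/
theorem blockExponent_add_quadratic_eq (e : m ⊕ₗ m ↪o J) (c : R) (Q : Matrix n m R)
    (Qb : Matrix m n R) (D : Matrix m m R) (ab a : n → J → R) :
    -(c • ∑ y, (ι R (ab y) - ∑ i, Qb i y • psiBarOf R e i) * (ι R (a y) - ∑ j, Q y j • psiOf R e j)) +
        ExteriorAlgebra.map (Function.ExtendByZero.linearMap R e) (quadratic R (-D)) =
      ExteriorAlgebra.map (Function.ExtendByZero.linearMap R e)
          (quadratic R (-(fluctuationOp c Q Qb D))) +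
        ∑ x, (ι R (srcBarVec R c Q ab x) * psiOf R e x + psiBarOf R e x * ι R (srcVec R c Qb a x)) +
        -(c • ∑ y, ι R (ab y) * ι R (a y)) := by
  have e1 : c • ∑ y, ι R (ab y) * ∑ x, Q y x • psiOf R e x =
      ∑ x, ι R (srcBarVec R c Q ab x) * psiOf R e x := by
    simp only [ι_srcBarVec, Finset.mul_sum, Finset.sum_mul, mul_smul_comm, smul_mul_assoc,
      Finset.smul_sum, smul_smul]
    exact Finset.sum_comm
  have e2 : c • ∑ y, (∑ x, Qb x y • psiBarOf R e x) * ι R (a y) =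
      ∑ x, psiBarOf R e x * ι R (srcVec R c Qb a x) := by
    simp only [ι_srcVec, Finset.mul_sum, Finset.sum_mul, mul_smul_comm, smul_mul_assoc,
      Finset.smul_sum, smul_smul]
    exact Finset.sum_comm
  have e3 : c • ∑ y, (∑ x, Qb x y • psiBarOf R e x) * ∑ x', Q y x' • psiOf R e x' =
      ∑ x, ∑ x', (c • (Qb * Q)) x x' • (psiBarOf R e x * psiOf R e x') := by
    simp only [Finset.sum_mul_sum, smul_mul_smul_comm, Finset.smul_sum, smul_smul]
    simp only [Matrix.smul_apply, Matrix.mul_apply, smul_eq_mul, Finset.mul_sum, Finset.sum_smul]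
    rw [Finset.sum_comm]
    refine Finset.sum_congr rfl fun x _ => ?_
    rw [Finset.sum_comm]
  rw [map_extendByZero_quadratic_eq_sum, map_extendByZero_quadratic_eq_sum, Finset.sum_add_distrib,
    ← e1, ← e2]
  simp only [Matrix.neg_apply, neg_smul, Finset.sum_neg_distrib, fluctuationOp, Matrix.add_apply,
    add_smul, Finset.sum_add_distrib, neg_add]
  rw [← e3]
  simp only [sub_mul, mul_sub, Finset.sum_sub_distrib, smul_sub]
  abel

omit [Fintype J] [LinearOrder m] [LinearOrder J] in
/-- **Recombination of the sources** after the Gaussian integration (the fourth expression of (211),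
`(b²/L²)(Q(A)ᵀΦ̄_L, C Q(−A)ᵀΦ_L)` as a quadratic form in the block field):
`Σ_{xx'} C_{xx'} J̄_x J_{x'} = Σ_{yy'} (c²QCQ̄)_{yy'} Φ̄_yΦ_{y'}`. [cite: Dimock2004QED3TorusII, App. A (211)] -/
theorem sum_smul_ι_srcBarVec_mul_ι_srcVec (c : R) (Q : Matrix n m R) (Qb : Matrix m n R)
    (ab a : n → J → R) (C : Matrix m m R) :
    ∑ x, ∑ x', C x x' • (ι R (srcBarVec R c Q ab x) * ι R (srcVec R c Qb a x')) =
      ∑ y, ∑ y', (c ^ 2 • (Q * C * Qb)) y y' • (ι R (ab y) * ι R (a y')) := by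
  simp only [ι_srcBarVec, ι_srcVec, Finset.sum_mul_sum, smul_mul_smul_comm, Finset.smul_sum, smul_smul]
  simp only [Matrix.smul_apply, Matrix.mul_apply, smul_eq_mul, Finset.mul_sum, Finset.sum_mul,
    Finset.sum_smul]
  calc ∑ x, ∑ x', ∑ y, ∑ y', (C x x' * (c * Q y x * (c * Qb x' y'))) • (ι R (ab y) * ι R (a y'))
      = ∑ x, ∑ y, ∑ x', ∑ y', (C x x' * (c * Q y x * (c * Qb x' y'))) • (ι R (ab y) * ι R (a y')) :=
        Finset.sum_congr rfl fun _ _ => Finset.sum_comm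
    _ = ∑ y, ∑ x, ∑ x', ∑ y', (C x x' * (c * Q y x * (c * Qb x' y'))) • (ι R (ab y) * ι R (a y')) :=
        Finset.sum_comm
    _ = ∑ y, ∑ x, ∑ y', ∑ x', (C x x' * (c * Q y x * (c * Qb x' y'))) • (ι R (ab y) * ι R (a y')) :=
        Finset.sum_congr rfl fun _ _ => Finset.sum_congr rfl fun _ _ => Finset.sum_comm
    _ = ∑ y, ∑ y', ∑ x, ∑ x', (C x x' * (c * Q y x * (c * Qb x' y'))) • (ι R (ab y) * ι R (a y')) :=
        Finset.sum_congr rfl fun _ _ => Finset.sum_comm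
    _ = ∑ y, ∑ y', ∑ x', ∑ x, (C x x' * (c * Q y x * (c * Qb x' y'))) • (ι R (ab y) * ι R (a y')) :=
        Finset.sum_congr rfl fun _ _ => Finset.sum_congr rfl fun _ _ => Finset.sum_comm
    _ = _ := by
        refine Finset.sum_congr rfl fun y _ => Finset.sum_congr rfl fun y' _ =>
          Finset.sum_congr rfl fun x' _ => Finset.sum_congr rfl fun x _ => ?_
        ring_nf

omit [Fintype J] [Fintype m] [LinearOrder m] [LinearOrder J] in
/-- The spectator term `cΦ̄Φ` as the quadratic form of the scalar matrix `c·1`. [folklore] -/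
private theorem smul_sum_ι_mul_ι_eq_sum_one_apply (c : R) (ab a : n → J → R) [DecidableEq n] :
    c • ∑ y, ι R (ab y) * ι R (a y) =
      ∑ y, ∑ y', (c • (1 : Matrix n n R)) y y' • (ι R (ab y) * ι R (a y')) := by
  simp only [Matrix.smul_apply, Matrix.one_apply, smul_eq_mul, mul_ite, mul_one, mul_zero, ite_smul,
    zero_smul, Finset.smul_sum]
  refine Finset.sum_congr rfl fun y _ => ?_
  rw [Finset.sum_ite_eq, if_pos (Finset.mem_univ y)]

variable [Algebra ℚ R] [DecidableEq n]

/-- **The Gaussian kernel identity, uncentred** (`η = 0`): for a block field `Φ̄_y = ι(ab y)`,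
`Φ_y = ι(a y)` of degree-one spectators and ANY fine action `D` with `F = D + cQ̄Q` invertible,
`∫dθ_s e^{−cΣ_y(Φ̄_y − (Ψ̄Q̄)_y)(Φ_y − (QΨ)_y)} e^{−Ψ̄DΨ} = ε det(−F) · e^{−Σ_{yy'}(D₁)_{yy'}Φ̄_yΦ_{y'}}`,
`D₁ = blockDirac c Q Q̄ D`, `ε = (−1)^{|m|(|m|−1)/2}` — Dimock (211) with `b_k(Ψ̄_k,Ψ_k)` replaced by a
general action (cf. his (38)–(40) for the same mechanism), BOS Lemma II.2 in the ambient algebra; it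
generalises the tree's `fermionBlockRG_grassmannExp_quadratic` (there `Φ` = the block generators `χ`).
Proof = the paper's: expand (`blockExponent_add_quadratic_eq`), take the central spectator `e^{−cΦ̄Φ}`
out of the integral, integrate with sources (`berezinOn_grassmannExp_quadratic_add_sources`), recombine
(`sum_smul_ι_srcBarVec_mul_ι_srcVec`). [cite: Dimock2004QED3TorusII, App. A Lemma 5 (211)] -/
theorem berezinOn_blockWeight_mul_gaussian (e : m ⊕ₗ m ↪o J) (c : R) (Q : Matrix n m R)
    (Qb : Matrix m n R) (D : Matrix m m R) (hF : IsUnit (fluctuationOp c Q Qb D).det)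
    (ab a : n → J → R) (hab : ∀ y k, ab y (e k) = 0) (ha : ∀ y k, a y (e k) = 0) :
    berezinOn R (Finset.univ.map e.toEmbedding)
        (grassmannExp (-(c • ∑ y, (ι R (ab y) - ∑ i, Qb i y • psiBarOf R e i) *
            (ι R (a y) - ∑ j, Q y j • psiOf R e j))) *
          grassmannExp (ExteriorAlgebra.map (Function.ExtendByZero.linearMap R e) (quadratic R (-D)))) =
      ((-1 : R) ^ (Fintype.card m * (Fintype.card m - 1) / 2) * (-fluctuationOp c Q Qb D).det) •
        grassmannExp (-(∑ y, ∑ y', blockDirac c Q Qb D y y' • (ι R (ab y) * ι R (a y')))) := by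
  -- notation
  set F := fluctuationOp c Q Qb D with hFdef
  set s : Finset J := Finset.univ.map e.toEmbedding with hs
  set Φ := ExteriorAlgebra.map (Function.ExtendByZero.linearMap R e) with hΦ
  set S : GrassmannAlgebra R J :=
    ∑ x, (ι R (srcBarVec R c Q ab x) * psiOf R e x + psiBarOf R e x * ι R (srcVec R c Qb a x)) with hS
  set Cq : GrassmannAlgebra R J := -(c • ∑ y, ι R (ab y) * ι R (a y)) with hCq
  set W : GrassmannAlgebra R J :=
    -(c • ∑ y, (ι R (ab y) - ∑ i, Qb i y • psiBarOf R e i) * (ι R (a y) - ∑ j, Q y j • psiOf R e j))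
    with hW
  -- units and inverses of `A = -F`
  have hAunit : IsUnit (-F).det := by
    rw [Matrix.det_neg]; exact ((isUnit_one.neg).pow _).mul hF
  have hAinv : (-F)⁻¹ = -F⁻¹ := by
    refine Matrix.inv_eq_left_inv ?_
    rw [neg_mul_neg, Matrix.nonsing_inv_mul _ hF]
  -- centrality ∕ nilpotency
  have hcΦ : ∀ (B : Matrix m m R) (z), Commute (Φ (quadratic R B)) z := fun B z =>
    commute_map_quadratic R Φ B (fun x y z => by
      rw [hΦ, gen, gen, ExteriorAlgebra.map_apply_ι, ExteriorAlgebra.map_apply_ι]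
      exact commute_ι_mul_ι _ _ z) z
  have hnΦ : ∀ B : Matrix m m R, IsNilpotent (Φ (quadratic R B)) := fun B =>
    (isNilpotent_quadratic R B).map _
  have hnS : IsNilpotent S := by
    refine Commute.isNilpotent_sum (fun i _ => ?_) fun i j _ _ => ?_
    · refine Commute.isNilpotent_add ?_ ⟨2, ?_⟩ ⟨2, ?_⟩
      · exact commute_ι_mul_ι _ _ _
      · rw [pow_two]; exact ι_mul_ι_mul_self _ _
      · rw [pow_two]; exact ι_mul_ι_mul_self _ _
    · exact Commute.add_left (commute_ι_mul_ι _ _ _) (commute_ι_mul_ι _ _ _)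
  have hcC : ∀ z, Commute Cq z := fun z => by
    rw [hCq]; exact Commute.neg_left (Commute.smul_left (Commute.sum_left _ _ _ fun y _ =>
      commute_ι_mul_ι _ _ z) c)
  have hnC : IsNilpotent Cq := by
    rw [hCq]
    refine IsNilpotent.neg (IsNilpotent.smul (Commute.isNilpotent_sum (fun y _ => ⟨2, ?_⟩)
      fun y y' _ _ => commute_ι_mul_ι _ _ _) c)
    rw [pow_two]; exact ι_mul_ι_mul_self _ _
  have hWeq : W = Φ (quadratic R (-F)) + S + Cq - Φ (quadratic R (-D)) := by
    rw [eq_sub_iff_add_eq, hW, hΦ, hFdef, hS, hCq]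
    exact blockExponent_add_quadratic_eq R e c Q Qb D ab a
  have hY : IsNilpotent (Φ (quadratic R (-F)) + S) := Commute.isNilpotent_add (hcΦ _ _) (hnΦ _) hnS
  have hnW : IsNilpotent W := by rw [hW]; exact isNilpotent_blockExponent R e c Q Qb ab a
  -- Step 1: the integrand is `exp (Φ(quadratic(-F)) + S) * exp Cq`
  have h1 : grassmannExp W * grassmannExp (Φ (quadratic R (-D))) =
      grassmannExp (Φ (quadratic R (-F)) + S) * grassmannExp Cq := by
    rw [grassmannExp, grassmannExp, grassmannExp, grassmannExp,
      ← IsNilpotent.exp_add_of_commute ((hcΦ _ _).symm) hnW (hnΦ _),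
      ← IsNilpotent.exp_add_of_commute ((hcC _).symm) hY hnC]
    congr 1
    rw [hWeq]; abel
  -- Step 2: Gaussian integral with sources over the integrated variables
  have h2 : berezinOn R s (grassmannExp (Φ (quadratic R (-F)) + S)) =
      ((-1 : R) ^ (Fintype.card m * (Fintype.card m - 1) / 2) * (-F).det) •
        grassmannExp (-∑ x, ∑ x', (-F)⁻¹ x x' •
          (ι R (srcBarVec R c Q ab x) * ι R (srcVec R c Qb a x'))) :=
    berezinOn_grassmannExp_quadratic_add_sources R e (-F) hAunit (srcBarVec R c Q ab)
      (srcVec R c Qb a) (fun x k => srcBarVec_apply_of_forall R c Q e hab x k)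
      (fun x k => srcVec_apply_of_forall R c Qb e ha x k)
  -- Step 3: the spectator `exp Cq` factors out of the integral
  have hCmem : grassmannExp Cq ∈ spectatorSubalgebra R s := by
    refine exp_mem_of_mem ?_ hnC
    rw [hCq]
    refine Subalgebra.neg_mem _ (Subalgebra.smul_mem _ (Subalgebra.sum_mem _ fun y _ =>
      Subalgebra.mul_mem _ (ι_mem_spectatorSubalgebra R fun i hi => ?_)
        (ι_mem_spectatorSubalgebra R fun i hi => ?_)) _)
    · obtain ⟨k, -, rfl⟩ := Finset.mem_map.1 hi; exact hab y k
    · obtain ⟨k, -, rfl⟩ := Finset.mem_map.1 hi; exact ha y k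
  have hCcomm : ∀ z, Commute (grassmannExp Cq) z := commute_exp_of_forall_commute hcC hnC
  -- Step 4: recombination of the exponent
  have h4 : -∑ x, ∑ x', (-F)⁻¹ x x' • (ι R (srcBarVec R c Q ab x) * ι R (srcVec R c Qb a x')) + Cq =
      -(∑ y, ∑ y', blockDirac c Q Qb D y y' • (ι R (ab y) * ι R (a y'))) := by
    rw [hAinv, sum_smul_ι_srcBarVec_mul_ι_srcVec, hCq, smul_sum_ι_mul_ι_eq_sum_one_apply,
      ← Finset.sum_neg_distrib, ← Finset.sum_neg_distrib, ← Finset.sum_add_distrib,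
      ← Finset.sum_neg_distrib]
    refine Finset.sum_congr rfl fun y _ => ?_
    rw [← Finset.sum_neg_distrib, ← Finset.sum_neg_distrib, ← Finset.sum_add_distrib,
      ← Finset.sum_neg_distrib]
    refine Finset.sum_congr rfl fun y' _ => ?_
    rw [← neg_smul, ← neg_smul, ← add_smul, ← neg_smul]
    congr 1
    simp only [blockDirac, ← hFdef, Matrix.sub_apply, Matrix.smul_apply, Matrix.mul_neg,
      Matrix.neg_mul, Matrix.neg_apply, smul_eq_mul]
    ring
  have hT : IsNilpotent (-∑ x, ∑ x', (-F)⁻¹ x x' •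
      (ι R (srcBarVec R c Q ab x) * ι R (srcVec R c Qb a x'))) :=
    (isNilpotent_sum_sum_smul_ι_mul_ι _ _ _).neg
  have hTc : ∀ z, Commute (-∑ x, ∑ x', (-F)⁻¹ x x' •
      (ι R (srcBarVec R c Q ab x) * ι R (srcVec R c Qb a x'))) z := fun z =>
    (commute_sum_sum_smul_ι_mul_ι _ _ _ z).neg_left
  -- assemble
  rw [h1, berezinOn_mul_of_mem_spectatorSubalgebra_of_commute R hCmem hCcomm, h2, smul_mul_assoc,
    grassmannExp, grassmannExp, ← IsNilpotent.exp_add_of_commute (hTc _) hT hnC, h4, grassmannExp]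

/-- **Dimock, App. A LEMMA 5 — the Gaussian kernel identity with a spectator CENTRE (general action).**
With integrated fermions `Ψ̄_k, Ψ_k` (placed by `e`), block field `Φ̄_y = ι(wbar y)`, `Φ_y = ι(w y)`
and centre `η̄_i = ι(ubar i)`, `η_i = ι(u i)` (all degree-one spectators), and `F = D + cQ̄Q` invertible:
`∫dθ_s e^{−cΣ_y(Φ̄_y − (Ψ̄Q̄)_y)(Φ_y − (QΨ)_y)} e^{−Σ_{ij}D_{ij}(Ψ̄_i − η̄_i)(Ψ_j − η_j)}
   = ε det(−F) · e^{−Σ_{yy'}(D₁)_{yy'}(Φ̄ − η̄Q̄)_y(Φ − Qη)_{y'}}`.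
Proof = the paper's first step: *"First shift `Ψ_k → Ψ_k + Q_kψ_L` and `Ψ̄_k → Ψ̄_k + Q_k(−)ψ̄_L` and
identify"* — the substitution `Ψ ↦ Ψ − η`, `Ψ̄ ↦ Ψ̄ − η̄` is a spectator shift (`IsSpectatorShift`; BOS's
*"translation formula"*), under which the Berezin integral is invariant (`IsSpectatorShift.berezinOn_map`)
and the integrand becomes the uncentred one with block field `Φ̄ − η̄Q̄`, `Φ − Qη`; then
`berezinOn_blockWeight_mul_gaussian`. [cite: Dimock2004QED3TorusII, App. A Lemma 5 (210)–(211)] -/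
theorem berezinOn_blockWeight_mul_centredGaussian (e : m ⊕ₗ m ↪o J) (c : R) (Q : Matrix n m R)
    (Qb : Matrix m n R) (D : Matrix m m R) (hF : IsUnit (fluctuationOp c Q Qb D).det)
    (wbar w : n → J → R) (ubar u : m → J → R)
    (hwbar : ∀ y k, wbar y (e k) = 0) (hw : ∀ y k, w y (e k) = 0)
    (hubar : ∀ i k, ubar i (e k) = 0) (hu : ∀ i k, u i (e k) = 0) :
    berezinOn R (Finset.univ.map e.toEmbedding)
        (grassmannExp (-(c • ∑ y, (ι R (wbar y) - ∑ i, Qb i y • psiBarOf R e i) *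
            (ι R (w y) - ∑ j, Q y j • psiOf R e j))) *
          grassmannExp (-(∑ i, ∑ j, D i j •
            ((psiBarOf R e i - ι R (ubar i)) * (psiOf R e j - ι R (u j)))))) =
      ((-1 : R) ^ (Fintype.card m * (Fintype.card m - 1) / 2) * (-fluctuationOp c Q Qb D).det) •
        grassmannExp (-(∑ y, ∑ y', blockDirac c Q Qb D y y' •
          (ι R (wbar y - ∑ i, Qb i y • ubar i) * ι R (w y' - ∑ j, Q y' j • u j)))) := by
  set s : Finset J := Finset.univ.map e.toEmbedding with hs
  set ab : n → J → R := fun y => wbar y - ∑ i, Qb i y • ubar i with hab_def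
  set a : n → J → R := fun y => w y - ∑ j, Q y j • u j with ha_def
  have hab : ∀ y k, ab y (e k) = 0 := fun y k => by
    simp only [hab_def, Pi.sub_apply, Finset.sum_apply, Pi.smul_apply, hwbar, hubar, smul_zero,
      Finset.sum_const_zero, sub_zero]
  have ha : ∀ y k, a y (e k) = 0 := fun y k => by
    simp only [ha_def, Pi.sub_apply, Finset.sum_apply, Pi.smul_apply, hw, hu, smul_zero,
      Finset.sum_const_zero, sub_zero]
  have hmems : ∀ {x}, x ∈ s ↔ ∃ k, e k = x := by
    intro x
    simp only [hs, Finset.mem_map, Finset.mem_univ, true_and, RelEmbedding.coe_toEmbedding]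
  -- the shift `Ψ ↦ Ψ − η`, `Ψ̄ ↦ Ψ̄ − η̄`
  set N : Module.End R (J → R) :=
    -(∑ j, (LinearMap.proj (e (toLex (Sum.inr j)))).smulRight (u j) +
      ∑ i, (LinearMap.proj (e (toLex (Sum.inl i)))).smulRight (ubar i)) with hN
  have hNapply : ∀ v : J → R, N v = -(∑ j, v (e (toLex (Sum.inr j))) • u j +
      ∑ i, v (e (toLex (Sum.inl i))) • ubar i) := by
    intro v
    simp only [hN, LinearMap.neg_apply, LinearMap.add_apply, LinearMap.sum_apply,
      LinearMap.smulRight_apply, LinearMap.proj_apply]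
  have hshift : IsSpectatorShift R s N := by
    refine ⟨fun x hx => ?_, fun y x hx => ?_⟩
    · rw [hNapply]
      have h1 : ∀ k, (Pi.single x (1 : R) : J → R) (e k) = 0 := fun k =>
        Pi.single_eq_of_ne (fun h : e k = x => hx (hmems.2 ⟨k, h⟩)) _
      simp only [h1, zero_smul, Finset.sum_const_zero, add_zero, neg_zero]
    · obtain ⟨k, rfl⟩ := hmems.1 hx
      rw [hNapply]
      simp only [Pi.neg_apply, Pi.add_apply, Finset.sum_apply, Pi.smul_apply, hu, hubar, smul_zero,
        Finset.sum_const_zero, add_zero, neg_zero]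
  have hne : ∀ i j : m, e (toLex (Sum.inl i)) ≠ e (toLex (Sum.inr j)) := fun i j h => by
    have := toLex_inj.1 (e.injective h); exact Sum.inl_ne_inr this
  have hNpb : ∀ i, N (Pi.single (e (toLex (Sum.inl i))) 1) = -ubar i := by
    intro i
    rw [hNapply]
    simp only [Pi.single_apply, (hne i _).symm, if_false, zero_smul, Finset.sum_const_zero, zero_add,
      e.injective.eq_iff, toLex_inj, Sum.inl.injEq, ite_smul, one_smul, Finset.sum_ite_eq',
      Finset.mem_univ, if_true]
  have hNp : ∀ j, N (Pi.single (e (toLex (Sum.inr j))) 1) = -u j := by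
    intro j
    rw [hNapply]
    simp only [Pi.single_apply, hne, if_false, zero_smul, Finset.sum_const_zero, add_zero,
      e.injective.eq_iff, toLex_inj, Sum.inr.injEq, ite_smul, one_smul, Finset.sum_ite_eq',
      Finset.mem_univ, if_true]
  have hMpb : ∀ i, ExteriorAlgebra.map (1 + N) (psiBarOf R e i) = psiBarOf R e i - ι R (ubar i) :=
    fun i => by rw [psiBarOf, map_one_add_gen, hNpb, map_neg, ← sub_eq_add_neg]
  have hMp : ∀ j, ExteriorAlgebra.map (1 + N) (psiOf R e j) = psiOf R e j - ι R (u j) :=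
    fun j => by rw [psiOf, map_one_add_gen, hNp, map_neg, ← sub_eq_add_neg]
  have hMι : ∀ v : J → R, (∀ k, v (e k) = 0) → ExteriorAlgebra.map (1 + N) (ι R v) = ι R v :=
    fun v hv => hshift.map_eq_self_of_mem R (ι_mem_spectatorSubalgebra R fun i hi => by
      obtain ⟨k, rfl⟩ := hmems.1 hi; exact hv k)
  -- uncentred exponents
  set W₀ : GrassmannAlgebra R J := -(c • ∑ y, (ι R (ab y) - ∑ i, Qb i y • psiBarOf R e i) *
    (ι R (a y) - ∑ j, Q y j • psiOf R e j)) with hW₀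
  set G₀ : GrassmannAlgebra R J :=
    ExteriorAlgebra.map (Function.ExtendByZero.linearMap R e) (quadratic R (-D)) with hG₀
  have hnW₀ : IsNilpotent W₀ := by rw [hW₀]; exact isNilpotent_blockExponent R e c Q Qb ab a
  have hnG₀ : IsNilpotent G₀ := (isNilpotent_quadratic R _).map _
  -- the shift maps the uncentred integrand to the centred one
  have hMW : ExteriorAlgebra.map (1 + N) W₀ = -(c • ∑ y, (ι R (wbar y) - ∑ i, Qb i y • psiBarOf R e i) *
      (ι R (w y) - ∑ j, Q y j • psiOf R e j)) := by
    rw [hW₀]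
    simp only [map_neg, map_smul, map_sum, map_mul, map_sub, hMpb, hMp, hMι _ (hab _), hMι _ (ha _)]
    congr 2
    refine Finset.sum_congr rfl fun y _ => ?_
    have e1 : ι R (ab y) - ∑ i, Qb i y • (psiBarOf R e i - ι R (ubar i)) =
        ι R (wbar y) - ∑ i, Qb i y • psiBarOf R e i := by
      simp only [hab_def, map_sub, map_sum, map_smul, smul_sub, Finset.sum_sub_distrib]; abel
    have e2 : ι R (a y) - ∑ j, Q y j • (psiOf R e j - ι R (u j)) =
        ι R (w y) - ∑ j, Q y j • psiOf R e j := by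
      simp only [ha_def, map_sub, map_sum, map_smul, smul_sub, Finset.sum_sub_distrib]; abel
    rw [e1, e2]
  have hMG : ExteriorAlgebra.map (1 + N) G₀ =
      -(∑ i, ∑ j, D i j • ((psiBarOf R e i - ι R (ubar i)) * (psiOf R e j - ι R (u j)))) := by
    rw [hG₀, map_extendByZero_quadratic_eq_sum]
    simp only [map_neg, map_sum, map_smul, map_mul, hMpb, hMp, Matrix.neg_apply, neg_smul,
      Finset.sum_neg_distrib]
  have key : grassmannExp (-(c • ∑ y, (ι R (wbar y) - ∑ i, Qb i y • psiBarOf R e i) *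
        (ι R (w y) - ∑ j, Q y j • psiOf R e j))) *
      grassmannExp (-(∑ i, ∑ j, D i j • ((psiBarOf R e i - ι R (ubar i)) * (psiOf R e j - ι R (u j))))) =
      ExteriorAlgebra.map (1 + N) (grassmannExp W₀ * grassmannExp G₀) := by
    rw [map_mul, grassmannExp, grassmannExp, grassmannExp, grassmannExp, IsNilpotent.map_exp hnW₀,
      IsNilpotent.map_exp hnG₀, hMW, hMG]
  rw [key, hshift.berezinOn_map R]
  exact berezinOn_blockWeight_mul_gaussian R e c Q Qb D hF ab a hab ha

/-! ### §3 LEMMA 5 ∕ (35) as printed: scalar action, `QQ̄ = 1` -/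

omit [Fintype J] [Algebra ℚ R] in
/-- A scalar fine action `b Σ_i (Ψ̄_i − η̄_i)(Ψ_i − η_i)` is the quadratic form of the matrix `b·1`.
[folklore] -/
private theorem smul_sum_sub_mul_sub_eq (e : m ⊕ₗ m ↪o J) (b : R) (ubar u : m → J → R) :
    b • ∑ i, (psiBarOf R e i - ι R (ubar i)) * (psiOf R e i - ι R (u i)) =
      ∑ i, ∑ j, (b • (1 : Matrix m m R)) i j •
        ((psiBarOf R e i - ι R (ubar i)) * (psiOf R e j - ι R (u j))) := by
  simp only [Matrix.smul_apply, Matrix.one_apply, smul_eq_mul, mul_ite, mul_one, mul_zero, ite_smul,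
    zero_smul, Finset.smul_sum, Finset.sum_ite_eq, Finset.mem_univ, if_true]

/-- **Dimock, App. A LEMMA 5 (210)–(211) ∕ the inductive kernel (35) of (30) — as printed, in the
notation (6) `|Φ − QΨ|² = (Φ̄ − Q(−A)Ψ̄, Φ − Q(A)Ψ)`:** for averaging data with `QQ̄ = 1`
(*"`Q_{e_k}(A)Q_{e_k}(−A)ᵀ = I`"*) and units `b` (his `b_k`), `b + c` (`c` = his `b/L`),
`∫dθ_s e^{−c|Φ − QΨ_k|²} e^{−b|Ψ_k − η|²} = ε det(−(b·1 + cQ̄Q)) · e^{−(cb∕(b+c))|Φ − Qη|²}`,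
i.e. *"= const exp(−b_{k+1}(Φ̄,Φ))"* with `b_{k+1} = bb_k/(b_k + bL⁻¹)` and, after the shift,
`Φ = Ψ_{k+1} − Q_{k+1}ψ`.  The constant is `ε det(−F)`, `ε = (−1)^{|m|(|m|−1)/2}`, evaluated in closed form
by `det_scalarFluctuationOp_eq`; the paper determines it by *"the left side integrates to one"* instead.
[cite: Dimock2004QED3TorusII, App. A Lemma 5 (210)–(211)] -/
theorem berezinOn_blockWeight_mul_centredScalarGaussian (e : m ⊕ₗ m ↪o J) {b c : R}
    (Q : Matrix n m R) (Qb : Matrix m n R) (hQ : Q * Qb = 1) (hb : IsUnit b) (hbc : IsUnit (b + c))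
    (wbar w : n → J → R) (ubar u : m → J → R)
    (hwbar : ∀ y k, wbar y (e k) = 0) (hw : ∀ y k, w y (e k) = 0)
    (hubar : ∀ i k, ubar i (e k) = 0) (hu : ∀ i k, u i (e k) = 0) :
    berezinOn R (Finset.univ.map e.toEmbedding)
        (grassmannExp (-(c • ∑ y, (ι R (wbar y) - ∑ i, Qb i y • psiBarOf R e i) *
            (ι R (w y) - ∑ j, Q y j • psiOf R e j))) *
          grassmannExp (-(b • ∑ i, (psiBarOf R e i - ι R (ubar i)) * (psiOf R e i - ι R (u i))))) =
      ((-1 : R) ^ (Fintype.card m * (Fintype.card m - 1) / 2) *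
          (-fluctuationOp c Q Qb (b • (1 : Matrix m m R))).det) •
        grassmannExp (-((c * b * Ring.inverse (b + c)) • ∑ y,
          ι R (wbar y - ∑ i, Qb i y • ubar i) * ι R (w y - ∑ j, Q y j • u j))) := by
  rw [smul_sum_sub_mul_sub_eq, berezinOn_blockWeight_mul_centredGaussian R e c Q Qb _
    (isUnit_det_scalarFluctuationOp Q Qb hQ hb hbc) wbar w ubar u hwbar hw hubar hu,
    blockDirac_scalar Q Qb hQ hb hbc]
  congr 2
  simp only [Matrix.smul_apply, Matrix.one_apply, smul_eq_mul, mul_ite, mul_one, mul_zero, ite_smul,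
    zero_smul, Finset.smul_sum, Finset.sum_ite_eq, Finset.mem_univ, if_true]

/-! ### §4 The composition law (BOS Lemma II.1 ∕ (1.3); Dimock (30), one step) -/

omit [Algebra ℚ R] [DecidableEq n] [LinearOrder m] [Fintype m] [Fintype n] [Fintype J] in
/-- Pair count behind the sign-free Fubini: for disjoint blocks `s`, `t`,
`#{(x,y) ∈ t × s | x < y} + #{(x,y) ∈ s × t | x < y} = |s||t|`. [folklore] -/
private theorem card_filter_lt_add_card_filter_lt {s t : Finset J} (hst : Disjoint s t) :
    ((t ×ˢ s).filter fun p => p.1 < p.2).card + ((s ×ˢ t).filter fun p => p.1 < p.2).card =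
      s.card * t.card := by
  have h1 : ((s ×ˢ t).filter fun p => p.1 < p.2).card =
      ((t ×ˢ s).filter fun p => p.2 < p.1).card := by
    refine Finset.card_bij (fun p _ => p.swap) (fun p hp => ?_) (fun p _ q _ h => ?_) (fun q hq => ?_)
    · simp only [Finset.mem_filter, Finset.mem_product] at hp ⊢
      exact ⟨⟨hp.1.2, hp.1.1⟩, hp.2⟩
    · exact Prod.swap_injective h
    · refine ⟨q.swap, ?_, Prod.swap_swap q⟩
      simp only [Finset.mem_filter, Finset.mem_product] at hq ⊢
      exact ⟨⟨hq.1.2, hq.1.1⟩, hq.2⟩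
  rw [h1, ← Finset.card_union_of_disjoint (Finset.disjoint_filter.2 fun p _ h h' => lt_asymm h h'),
    ← Finset.filter_or, Finset.filter_true_of_mem, Finset.card_product, mul_comm]
  intro p hp
  obtain ⟨h1, h2⟩ := Finset.mem_product.1 hp
  rcases lt_trichotomy p.1 p.2 with h | h | h
  · exact Or.inl h
  · exact absurd h2 (h ▸ Finset.disjoint_right.1 hst h1)
  · exact Or.inr h

omit [Algebra ℚ R] [DecidableEq n] [LinearOrder m] [Fintype m] [Fintype n] in
/-- **Sign-free Fubini for an even block** (Berezin 1966, Ch. I §3: the multiple Berezin integral as an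
iterated one, blocks of even total degree commuting with everything): partial Berezin integrals over
disjoint blocks commute, `∫dθ_s ∫dθ_t = ∫dθ_t ∫dθ_s`, when one block has even size — in particular
for a fermion block `Ψ̄_k, Ψ_k` (`2|m|` generators), whatever its position in the ambient order (from
the tree's `berezinOn_berezinOn`, whose two signs differ by `(−1)^{|s||t|}`). [cite: Berezin1966, Ch. I §3] -/
theorem berezinOn_comm_of_even {s t : Finset J} (hst : Disjoint s t) (hs : Even s.card)
    (x : GrassmannAlgebra R J) :
    berezinOn R s (berezinOn R t x) = berezinOn R t (berezinOn R s x) := by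
  rw [berezinOn_berezinOn R hst, berezinOn_berezinOn R hst.symm, Finset.union_comm t s,
    intCast_berezinSign, intCast_berezinSign, Finset.union_sdiff_cancel_right hst,
    Finset.union_sdiff_cancel_left hst]
  congr 1
  have h := card_filter_lt_add_card_filter_lt hst
  obtain ⟨k, hk⟩ := hs
  have hE : Even (((t ×ˢ s).filter fun p => p.1 < p.2).card +
      ((s ×ˢ t).filter fun p => p.1 < p.2).card) := by
    rw [h, hk, ← two_mul, mul_assoc]; exact even_two_mul _
  rcases Nat.even_or_odd ((t ×ˢ s).filter fun p => p.1 < p.2).card with h1 | h1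
  · have h2 : Even ((s ×ˢ t).filter fun p => p.1 < p.2).card := by
      simpa [Nat.even_add, h1] using hE
    rw [h1.neg_one_pow, h2.neg_one_pow]
  · have h2 : Odd ((s ×ˢ t).filter fun p => p.1 < p.2).card := by
      have := Nat.even_add.1 hE
      exact Nat.not_even_iff_odd.1 (fun h2 => (Nat.not_even_iff_odd.2 h1) (this.2 h2))
    rw [h1.neg_one_pow, h2.neg_one_pow]

variable {p : Type*} [LinearOrder p] [Fintype p]

omit [Algebra ℚ R] [DecidableEq n] [Fintype J] [Fintype n] [LinearOrder m] [LinearOrder J]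
  [LinearOrder p] in
/-- *"identify `Q_{k+1}`"*: the centre of the composite step, `Σ_i Q̄_{iy}(φ̄R̄)_i = (φ̄(R̄Q̄))_y` as a
vector identity. [cite: Dimock2004QED3TorusII, App. A Lemma 5] -/
theorem sub_sum_smul_sum_smul_eq (Qb : Matrix m n R) (Rb : Matrix p m R) (wbar : n → J → R) (y : n)
    (g : p → J → R) :
    wbar y - ∑ i, Qb i y • ∑ l, Rb l i • g l = wbar y - ∑ l, (Rb * Qb) l y • g l := by
  congr 1
  simp only [Finset.smul_sum, smul_smul, Matrix.mul_apply, Finset.sum_smul]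
  rw [Finset.sum_comm]
  exact Finset.sum_congr rfl fun l _ => Finset.sum_congr rfl fun i _ => by rw [mul_comm]

omit [Algebra ℚ R] [DecidableEq n] [Fintype J] [Fintype n] [LinearOrder m] [LinearOrder J]
  [LinearOrder p] in
/-- *"identify `Q_{k+1}`"*, unbarred: `Σ_j Q_{yj}(Rφ)_j = ((QR)φ)_y`. [cite: Dimock2004QED3TorusII, App. A Lemma 5] -/
theorem sub_sum_smul_sum_smul_eq' (Q : Matrix n m R) (Rm : Matrix m p R) (w : n → J → R) (y : n)
    (g : p → J → R) :
    w y - ∑ j, Q y j • ∑ l, Rm j l • g l = w y - ∑ l, (Q * Rm) y l • g l := by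
  congr 1
  simp only [Finset.smul_sum, smul_smul, Matrix.mul_apply, Finset.sum_smul]
  rw [Finset.sum_comm]

/-- **The composition law of the fermionic block RG — Bałaban–O'Carroll–Schor Lemma II.1 ∕ (1.3)
(`T^{L^kε}_{a,L}T^ε_{a_k,L^k} = T^ε_{a_{k+1},L^{k+1}}`, `1/a_{k+1} = L⁻¹/a_k + 1/a`), Dimock (30) one
step ∕ (35), in the ambient algebra.**  Three fermion families: the block field `Φ̄_y = ι(wbar y)`,
`Φ_y = ι(w y)` (degree-one spectators off both integrated blocks), the middle field `Ψ̄, Ψ` placed by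
`e : m ⊕ₗ m ↪o J` and the fine field `φ̄, φ` placed by `f : p ⊕ₗ p ↪o J` with disjoint ranges; averaging
data `Q, Q̄` (middle → block, `QQ̄ = 1`) and `R, R̄` (fine → middle, arbitrary), weights `c` and `b` with
`b`, `b + c` units; and ANY density `ρ` free of `Ψ̄, Ψ` (a spectator of the middle block — a function of
`φ̄, φ` and of any further spectators).  Then
`∫dθ_{s_e} e^{−c|Φ − QΨ|²} (∫dθ_{s_f} e^{−b|Ψ − Rφ|²} ρ) = ε det(−(b·1 + cQ̄Q)) · ∫dθ_{s_f} e^{−b'|Φ − (QR)φ|²} ρ`,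
`b' = cb∕(b+c)`, conjugate data `R̄Q̄`, in the notation (6).  Proof = BOS's (*"do the `ψ` integral, use
`QQ* = I`, and equate the coefficients"*): the outer weight is a spectator of the `f`-integral
(`grassmannExp_blockExponent_mem_spectatorSubalgebra`), the two integrals commute without sign
(`berezinOn_comm_of_even`), `ρ` leaves the middle integral (spectator linearity), and the middle integral
is LEMMA 5 (`berezinOn_blockWeight_mul_centredScalarGaussian`) with centre `η = Rφ`.
[cite: BalabanOcarrollSchor1989, §II Lemma II.1] -/
theorem berezinOn_blockWeight_mul_berezinOn_blockWeight_mul (e : m ⊕ₗ m ↪o J) (f : p ⊕ₗ p ↪o J)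
    (hef : ∀ k l, e k ≠ f l) {b c : R} (Q : Matrix n m R) (Qb : Matrix m n R) (hQ : Q * Qb = 1)
    (hb : IsUnit b) (hbc : IsUnit (b + c)) (Rm : Matrix m p R) (Rb : Matrix p m R)
    (wbar w : n → J → R) (hwbar : ∀ y k, wbar y (e k) = 0) (hw : ∀ y k, w y (e k) = 0)
    (hwbar' : ∀ y l, wbar y (f l) = 0) (hw' : ∀ y l, w y (f l) = 0)
    (ρ : GrassmannAlgebra R J) (hρ : ρ ∈ spectatorSubalgebra R (Finset.univ.map e.toEmbedding)) :
    berezinOn R (Finset.univ.map e.toEmbedding)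
        (grassmannExp (-(c • ∑ y, (ι R (wbar y) - ∑ i, Qb i y • psiBarOf R e i) *
            (ι R (w y) - ∑ j, Q y j • psiOf R e j))) *
          berezinOn R (Finset.univ.map f.toEmbedding)
            (grassmannExp (-(b • ∑ i, (psiBarOf R e i - ∑ l, Rb l i • psiBarOf R f l) *
                (psiOf R e i - ∑ l, Rm i l • psiOf R f l))) * ρ)) =
      ((-1 : R) ^ (Fintype.card m * (Fintype.card m - 1) / 2) *
          (-fluctuationOp c Q Qb (b • (1 : Matrix m m R))).det) •
        berezinOn R (Finset.univ.map f.toEmbedding)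
          (grassmannExp (-((c * b * Ring.inverse (b + c)) • ∑ y,
              (ι R (wbar y) - ∑ l, (Rb * Qb) l y • psiBarOf R f l) *
                (ι R (w y) - ∑ l, (Q * Rm) y l • psiOf R f l))) * ρ) := by
  set se : Finset J := Finset.univ.map e.toEmbedding with hse
  set sf : Finset J := Finset.univ.map f.toEmbedding with hsf
  have hmeme : ∀ {x}, x ∈ se ↔ ∃ k, e k = x := by
    intro x; simp only [hse, Finset.mem_map, Finset.mem_univ, true_and, RelEmbedding.coe_toEmbedding]
  have hmemf : ∀ {x}, x ∈ sf ↔ ∃ k, f k = x := by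
    intro x; simp only [hsf, Finset.mem_map, Finset.mem_univ, true_and, RelEmbedding.coe_toEmbedding]
  have hdisj : Disjoint se sf := by
    refine Finset.disjoint_left.2 fun x hx hx' => ?_
    obtain ⟨k, rfl⟩ := hmeme.1 hx
    obtain ⟨l, hl⟩ := hmemf.1 hx'
    exact hef k l hl.symm
  have hfe : ∀ l k, f l ≠ e k := fun l k h => hef k l h.symm
  have heven : Even se.card := by
    rw [hse, Finset.card_map, Finset.card_univ, Fintype.card_lex, Fintype.card_sum]; exact ⟨_, rfl⟩
  -- the centre `η̄ = φ̄R̄`, `η = Rφ` as spectator vectors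
  set ubar : m → J → R := fun i => ∑ l, Rb l i • (Pi.single (f (toLex (Sum.inl l))) 1 : J → R)
    with hubar_def
  set u : m → J → R := fun i => ∑ l, Rm i l • (Pi.single (f (toLex (Sum.inr l))) 1 : J → R)
    with hu_def
  have hιubar : ∀ i, ι R (ubar i) = ∑ l, Rb l i • psiBarOf R f l := fun i => by
    simp only [hubar_def, map_sum, map_smul, psiBarOf, gen]
  have hιu : ∀ i, ι R (u i) = ∑ l, Rm i l • psiOf R f l := fun i => by
    simp only [hu_def, map_sum, map_smul, psiOf, gen]
  have hubar : ∀ i k, ubar i (e k) = 0 := fun i k => by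
    simp only [hubar_def, Finset.sum_apply, Pi.smul_apply, Pi.single_apply, hef, if_false, smul_zero,
      Finset.sum_const_zero]
  have hu : ∀ i k, u i (e k) = 0 := fun i k => by
    simp only [hu_def, Finset.sum_apply, Pi.smul_apply, Pi.single_apply, hef, if_false, smul_zero,
      Finset.sum_const_zero]
  -- the three Grassmann weights
  set Wc : GrassmannAlgebra R J := grassmannExp (-(c • ∑ y,
    (ι R (wbar y) - ∑ i, Qb i y • psiBarOf R e i) * (ι R (w y) - ∑ j, Q y j • psiOf R e j))) with hWc
  set Wb : GrassmannAlgebra R J := grassmannExp (-(b • ∑ i,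
    (psiBarOf R e i - ∑ l, Rb l i • psiBarOf R f l) * (psiOf R e i - ∑ l, Rm i l • psiOf R f l))) with hWb
  -- (1) `Wc` is a spectator of the `f`-integral, and central
  have hWc_spec : Wc ∈ spectatorSubalgebra R sf :=
    grassmannExp_blockExponent_mem_spectatorSubalgebra R e c Q Qb wbar w
      (fun k hk => by obtain ⟨l, hl⟩ := hmemf.1 hk; exact hef k l hl.symm)
      (fun y x hx => by obtain ⟨l, rfl⟩ := hmemf.1 hx; exact hwbar' y l)
      (fun y x hx => by obtain ⟨l, rfl⟩ := hmemf.1 hx; exact hw' y l)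
  have hWc_comm : ∀ z, Commute Wc z :=
    commute_exp_of_forall_commute (commute_blockExponent R e c Q Qb wbar w)
      (isNilpotent_blockExponent R e c Q Qb wbar w)
  -- (2) `Wb` is the centred scalar Gaussian of the middle block with centre `Rφ`, and central
  have hWb_eq : Wb = grassmannExp (-(b • ∑ i,
      (psiBarOf R e i - ι R (ubar i)) * (psiOf R e i - ι R (u i)))) := by
    simp only [hWb, hιubar, hιu]
  have hWb_exp_eq : -(b • ∑ i, (psiBarOf R e i - ι R (ubar i)) * (psiOf R e i - ι R (u i))) =
      -(b • ∑ i, ι R ((Pi.single (e (toLex (Sum.inl i))) 1 : J → R) - ubar i) *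
        ι R ((Pi.single (e (toLex (Sum.inr i))) 1 : J → R) - u i)) := by
    simp only [map_sub, psiBarOf, psiOf, gen]
  have hnWb : IsNilpotent (-(b • ∑ i, (psiBarOf R e i - ι R (ubar i)) * (psiOf R e i - ι R (u i)))) := by
    rw [hWb_exp_eq]
    refine IsNilpotent.neg (IsNilpotent.smul (Commute.isNilpotent_sum (fun y _ => ⟨2, ?_⟩)
      fun y y' _ _ => commute_ι_mul_ι _ _ _) b)
    rw [pow_two]; exact ι_mul_ι_mul_self _ _
  have hWb_comm : ∀ z, Commute Wb z := by
    rw [hWb_eq]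
    refine commute_exp_of_forall_commute (fun z => ?_) hnWb
    rw [hWb_exp_eq]
    exact (Commute.smul_left (Commute.sum_left _ _ _ fun y _ => commute_ι_mul_ι _ _ z) b).neg_left
  -- (3) the Gaussian integral over the middle block = LEMMA 5 with centre `Rφ`
  have hgauss : berezinOn R se (Wc * Wb) =
      ((-1 : R) ^ (Fintype.card m * (Fintype.card m - 1) / 2) *
          (-fluctuationOp c Q Qb (b • (1 : Matrix m m R))).det) •
        grassmannExp (-((c * b * Ring.inverse (b + c)) • ∑ y,
          ι R (wbar y - ∑ i, Qb i y • ubar i) * ι R (w y - ∑ j, Q y j • u j))) := by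
    rw [hWb_eq]
    exact berezinOn_blockWeight_mul_centredScalarGaussian R e Q Qb hQ hb hbc wbar w ubar u hwbar hw
      hubar hu
  -- (4) *"identify Q_{k+1}"*: the resulting weight is the composite block-spin weight
  have hG_eq : grassmannExp (-((c * b * Ring.inverse (b + c)) • ∑ y,
          ι R (wbar y - ∑ i, Qb i y • ubar i) * ι R (w y - ∑ j, Q y j • u j))) =
      grassmannExp (-((c * b * Ring.inverse (b + c)) • ∑ y,
        (ι R (wbar y) - ∑ l, (Rb * Qb) l y • psiBarOf R f l) *
          (ι R (w y) - ∑ l, (Q * Rm) y l • psiOf R f l))) := by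
    congr 3
    refine Finset.sum_congr rfl fun y _ => ?_
    rw [hubar_def, hu_def, sub_sum_smul_sum_smul_eq R Qb Rb wbar y, sub_sum_smul_sum_smul_eq' R Q Rm w y,
      ι_sub_sum_smul_single_inl, ι_sub_sum_smul_single_inr]
  have hcG : ∀ z, Commute (grassmannExp (-((c * b * Ring.inverse (b + c)) • ∑ y,
      (ι R (wbar y) - ∑ l, (Rb * Qb) l y • psiBarOf R f l) *
        (ι R (w y) - ∑ l, (Q * Rm) y l • psiOf R f l)))) z :=
    commute_exp_of_forall_commute (commute_blockExponent R f _ _ _ wbar w)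
      (isNilpotent_blockExponent R f _ _ _ wbar w)
  -- assemble: BOS's proof
  have hWcWb : ∀ z, Commute (Wc * Wb) z := fun z => (hWc_comm z).mul_left (hWb_comm z)
  rw [← berezinOn_mul_of_mem_spectatorSubalgebra R hWc_spec, berezinOn_comm_of_even R hdisj heven,
    ← mul_assoc, (hWcWb ρ).eq, berezinOn_mul_of_mem_spectatorSubalgebra R hρ, hgauss, hG_eq,
    mul_smul_comm, map_smul, ← (hcG ρ).eq]

end Kernel

/-! ### §5 Corollary in the tree's two-algebra framework -/

section TwoAlgebra

variable (R : Type*) [CommRing R] [Algebra ℚ R]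
variable {m n : Type*} [LinearOrder m] [Fintype m] [LinearOrder n] [Fintype n]

/-- **The tree's block RG transformation on a scalar Gaussian density**: for `QQ̄ = 1` and units `b`,
`b + c`, `fermionBlockRG c Q Q̄ (e^{−bψ̄ψ}) = ε det(−(b·1 + cQ̄Q)) • e^{−(cb∕(b+c))χ̄χ}` — BOS Lemma II.1
∕ Dimock LEMMA 5 with centre `0`, read in the tree's `Λ(ψ̄,ψ) → Λ(χ̄,χ)` formulation (from the tree's
`fermionBlockRG_grassmannExp_quadratic` and `blockDirac_scalar`). [cite: BalabanOcarrollSchor1989, §II Lemma II.1] -/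
theorem fermionBlockRG_grassmannExp_scalar {b c : R} (Q : Matrix n m R) (Qb : Matrix m n R)
    (hQ : Q * Qb = 1) (hb : IsUnit b) (hbc : IsUnit (b + c)) :
    fermionBlockRG R c Q Qb (grassmannExp (quadratic R (-(b • (1 : Matrix m m R))))) =
      ((-1 : R) ^ (Fintype.card m * (Fintype.card m - 1) / 2) *
          (-fluctuationOp c Q Qb (b • (1 : Matrix m m R))).det) •
        grassmannExp (quadratic R (-((c * b * Ring.inverse (b + c)) • (1 : Matrix n n R)))) := by
  rw [fermionBlockRG_grassmannExp_quadratic R c Q Qb _ (isUnit_det_scalarFluctuationOp Q Qb hQ hb hbc),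
    blockDirac_scalar Q Qb hQ hb hbc]

end TwoAlgebra

/-! ### §6 The composition law for the tree's transformations `fermionBlockRG` (BOS Lemma II.1 as an
identity of linear maps `Λ(φ̄,φ) → Λ(χ̄,χ)`) -/

section Transport

variable (R : Type*) [CommRing R]
variable {K J : Type*} [LinearOrder K] [Fintype K] [LinearOrder J] [Fintype J]

/-- **Spectators of a co-block come from the sub-algebra**: if every index outside `t` is in the range
of the order embedding `g`, an element of `Λ(J)` involving no generator of `t` is the image of an
element of `Λ(K)` under the embedding along `g` (the tree's
`BlockFermionRG.exists_map_inlLex_eq_of_mem_spectatorSubalgebra` for a general embedding). [folklore] -/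
private theorem exists_map_extendByZero_eq_of_mem_spectatorSubalgebra (g : K ↪o J) {t : Finset J}
    (hcover : ∀ j, j ∉ t → ∃ k, g k = j) {z : GrassmannAlgebra R J}
    (hz : z ∈ spectatorSubalgebra R t) :
    ∃ w : GrassmannAlgebra R K, ExteriorAlgebra.map (Function.ExtendByZero.linearMap R g) w = z := by
  suffices h : Submodule.span R (grassmannBasis R J '' {u | Disjoint u t}) ≤
      LinearMap.range (ExteriorAlgebra.map (Function.ExtendByZero.linearMap R g)).toLinearMap by
    obtain ⟨w, hw⟩ := LinearMap.mem_range.1 (h (mem_spectatorSubalgebra_iff.1 hz))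
    exact ⟨w, hw⟩
  refine Submodule.span_le.2 ?_
  rintro _ ⟨u, hu, rfl⟩
  have htu : (Finset.univ.filter fun k => g k ∈ u).map g.toEmbedding = u := by
    ext j
    simp only [Finset.mem_map, Finset.mem_filter, Finset.mem_univ, true_and,
      RelEmbedding.coe_toEmbedding]
    constructor
    · rintro ⟨k, hk, rfl⟩; exact hk
    · intro hj
      obtain ⟨k, rfl⟩ := hcover j (fun hjt => Finset.disjoint_left.1 hu hj hjt)
      exact ⟨k, hj, rfl⟩
  refine LinearMap.mem_range.2 ⟨grassmannBasis R K (Finset.univ.filter fun k => g k ∈ u), ?_⟩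
  rw [AlgHom.toLinearMap_apply, map_extendByZero_grassmannBasis, htu]

end Transport

section TwoAlgebraComposition

variable (R : Type*) [CommRing R] [Algebra ℚ R]
variable {m n : Type*} [LinearOrder m] [Fintype m] [LinearOrder n] [Fintype n]
variable {J : Type*} [LinearOrder J] [Fintype J]

/-- **The tree's block RG transformation read in any ambient algebra.**  For an order embedding
`E : BlockRGIdx n m ↪o J` of the joint index type of one step into a bigger one,
`E_*(χ-embedding (T_{a,Q} x)) = ∫dθ_{E(fine)} (E_* W · E_*(ψ-embedding x))`: the defining partial
integral of `fermionBlockRG` (BOS (1.1)) computed inside `Λ(J)`. [cite: BalabanOcarrollSchor1989, §I (1.1)] -/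
theorem map_extendByZero_fermionBlockRG (E : BlockRGIdx n m ↪o J) (a : R) (Q : Matrix n m R)
    (Qb : Matrix m n R) (x : GrassmannAlgebra R (m ⊕ₗ m)) :
    ExteriorAlgebra.map (Function.ExtendByZero.linearMap R ((inlLex (n ⊕ₗ n) (m ⊕ₗ m)).trans E))
        (fermionBlockRG R a Q Qb x) =
      berezinOn R (Finset.univ.map ((inrLex (n ⊕ₗ n) (m ⊕ₗ m)).trans E).toEmbedding)
        (ExteriorAlgebra.map (Function.ExtendByZero.linearMap R E) (blockRGWeight R a Q Qb) *
          ExteriorAlgebra.map (Function.ExtendByZero.linearMap R ((inrLex (n ⊕ₗ n) (m ⊕ₗ m)).trans E))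
            x) := by
  set B := berezinOn R (Finset.univ.map (inrLex (n ⊕ₗ n) (m ⊕ₗ m)).toEmbedding)
    (blockRGWeight R a Q Qb *
      ExteriorAlgebra.map (Function.ExtendByZero.linearMap R (inrLex (n ⊕ₗ n) (m ⊕ₗ m))) x) with hB
  have hBspec : B ∈ spectatorSubalgebra R (Finset.univ.map (inrLex (n ⊕ₗ n) (m ⊕ₗ m)).toEmbedding) :=
    berezinOn_mem_spectatorSubalgebra_self R _ _
  have hcover : ∀ j : BlockRGIdx n m, j ∉ (Finset.univ.map (inrLex (n ⊕ₗ n) (m ⊕ₗ m)).toEmbedding) →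
      ∃ k, inlLex (n ⊕ₗ n) (m ⊕ₗ m) k = j := by
    intro j hj
    cases h : ofLex j with
    | inl k => exact ⟨k, by rw [← toLex_ofLex j, h]; rfl⟩
    | inr k => exact absurd (Finset.mem_map.2 ⟨k, Finset.mem_univ k, by rw [← toLex_ofLex j, h]; rfl⟩) hj
  obtain ⟨w, hw⟩ := exists_map_extendByZero_eq_of_mem_spectatorSubalgebra R
    (inlLex (n ⊕ₗ n) (m ⊕ₗ m)) hcover hBspec
  have hT : fermionBlockRG R a Q Qb x = w := by
    rw [fermionBlockRG_apply, ← hB, ← hw, map_funLeft_map_extendByZero_inlLex]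
  rw [hT, ← map_extendByZero_map_extendByZero, ← map_extendByZero_map_extendByZero, hw, hB,
    ← berezinOn_map_map_extendByZero, map_mul, Finset.map_map]
  rfl

omit [Fintype J] in
/-- The block-spin weight of the tree read in an ambient algebra: generators go to generators.
[cite: BalabanOcarrollSchor1989, §I (1.1)] -/
theorem map_extendByZero_blockRGWeight (E : BlockRGIdx n m ↪o J) (a : R) (Q : Matrix n m R)
    (Qb : Matrix m n R) :
    ExteriorAlgebra.map (Function.ExtendByZero.linearMap R E) (blockRGWeight R a Q Qb) =
      grassmannExp (-(a • ∑ y,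
        (ι R (Pi.single (E (inlLex (n ⊕ₗ n) (m ⊕ₗ m) (toLex (Sum.inl y)))) 1) -
            ∑ x, Qb x y • psiBarOf R ((inrLex (n ⊕ₗ n) (m ⊕ₗ m)).trans E) x) *
          (ι R (Pi.single (E (inlLex (n ⊕ₗ n) (m ⊕ₗ m) (toLex (Sum.inr y)))) 1) -
            ∑ x, Q y x • psiOf R ((inrLex (n ⊕ₗ n) (m ⊕ₗ m)).trans E) x))) := by
  have hnil : IsNilpotent (blockRGExponent R a Q Qb) := by
    have := isNilpotent_blockExponent R (inrLex (n ⊕ₗ n) (m ⊕ₗ m)) a Q Qb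
      (fun y => Pi.single (inlLex (n ⊕ₗ n) (m ⊕ₗ m) (toLex (Sum.inl y))) 1)
      (fun y => Pi.single (inlLex (n ⊕ₗ n) (m ⊕ₗ m) (toLex (Sum.inr y))) 1)
    simpa only [blockRGExponent, chiBar, chi, psiBarF, psiF, psiBarOf, psiOf, gen] using this
  rw [blockRGWeight, grassmannExp, grassmannExp, IsNilpotent.map_exp hnil, blockRGExponent]
  congr 1
  simp only [map_neg, map_smul, map_sum, map_mul, map_sub, chiBar, chi, psiBarF, psiF, psiBarOf, psiOf,
    gen, ExteriorAlgebra.map_apply_ι, extendByZero_single, RelEmbedding.coe_trans, Function.comp_apply]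

variable {p : Type*} [LinearOrder p] [Fintype p]

/-- The order embedding `α ⊕ₗ γ ↪o α ⊕ₗ (β ⊕ₗ γ)` skipping the middle summand (block indices and
fine indices of the composite step inside the three-family index type). [folklore] -/
def skipMiddleLex (α β γ : Type*) [LinearOrder α] [LinearOrder β] [LinearOrder γ] :
    α ⊕ₗ γ ↪o α ⊕ₗ (β ⊕ₗ γ) :=
  OrderEmbedding.ofStrictMono
    (fun x => toLex (Sum.map id (fun c => toLex (Sum.inr c)) (ofLex x)))
    (fun x y h => by
      rw [Sum.Lex.lt_def] at h ⊢
      simp only [ofLex_toLex]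
      exact (RelEmbedding.sumLexMap (RelEmbedding.refl _)
        (inrLex β γ).ltEmbedding).map_rel_iff.2 h)

/-- The order embedding `α ⊕ₗ β ↪o α ⊕ₗ (β ⊕ₗ γ)` onto the first two summands (the joint index type
of the outer step inside the three-family index type). [folklore] -/
def frontLex (α β γ : Type*) [LinearOrder α] [LinearOrder β] [LinearOrder γ] :
    α ⊕ₗ β ↪o α ⊕ₗ (β ⊕ₗ γ) :=
  OrderEmbedding.ofStrictMono
    (fun x => toLex (Sum.map id (fun b => toLex (Sum.inl b)) (ofLex x)))
    (fun x y h => by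
      rw [Sum.Lex.lt_def] at h ⊢
      simp only [ofLex_toLex]
      exact (RelEmbedding.sumLexMap (RelEmbedding.refl _)
        (inlLex β γ).ltEmbedding).map_rel_iff.2 h)

/-- **The composition law of Bałaban–O'Carroll–Schor, Lemma II.1 ∕ (1.3), for the tree's block RG
transformations** (Dimock (30): `k` steps compose into one): for averaging data `Q, Q̄` with
`QQ̄ = 1` (middle → block), arbitrary `R, R̄` (fine → middle) and units `b`, `b + c`,
`T_{c,Q,Q̄} (T_{b,R,R̄} ρ) = ε det(−(b·1 + cQ̄Q)) • T_{cb/(b+c), QR, R̄Q̄} ρ` for EVERY density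
`ρ ∈ Λ(φ̄,φ)`, `ε = (−1)^{|m|(|m|−1)/2}` (so `N_c T_c ∘ N_b T_b = N_{b'} T_{b'}` for the normalised maps,
by `det_scalarFluctuationOp_eq`).  Proof: read all three transformations in the three-family algebra
`Λ((n⊕n) ⊕ ((m⊕m) ⊕ (p⊕p)))` (`map_extendByZero_fermionBlockRG`), apply the ambient composition law
`berezinOn_blockWeight_mul_berezinOn_blockWeight_mul`, and pull back along the injective embedding of
`Λ(χ̄,χ)`. [cite: BalabanOcarrollSchor1989, §II Lemma II.1] -/
theorem fermionBlockRG_fermionBlockRG {b c : R} (Q : Matrix n m R) (Qb : Matrix m n R)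
    (hQ : Q * Qb = 1) (hb : IsUnit b) (hbc : IsUnit (b + c)) (Rm : Matrix m p R) (Rb : Matrix p m R)
    (ρ : GrassmannAlgebra R (p ⊕ₗ p)) :
    fermionBlockRG R c Q Qb (fermionBlockRG R b Rm Rb ρ) =
      ((-1 : R) ^ (Fintype.card m * (Fintype.card m - 1) / 2) *
          (-fluctuationOp c Q Qb (b • (1 : Matrix m m R))).det) •
        fermionBlockRG R (c * b * Ring.inverse (b + c)) (Q * Rm) (Rb * Qb) ρ := by
  -- the three-family index type and the embeddings of the three joint index types into it
  let JJ := (n ⊕ₗ n) ⊕ₗ ((m ⊕ₗ m) ⊕ₗ (p ⊕ₗ p))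
  let E₁ : BlockRGIdx m p ↪o JJ := inrLex (n ⊕ₗ n) ((m ⊕ₗ m) ⊕ₗ (p ⊕ₗ p))
  let E₂ : BlockRGIdx n m ↪o JJ := frontLex (n ⊕ₗ n) (m ⊕ₗ m) (p ⊕ₗ p)
  let E₃ : BlockRGIdx n p ↪o JJ := skipMiddleLex (n ⊕ₗ n) (m ⊕ₗ m) (p ⊕ₗ p)
  let ιC : n ⊕ₗ n ↪o JJ := inlLex (n ⊕ₗ n) ((m ⊕ₗ m) ⊕ₗ (p ⊕ₗ p))
  let ιM : m ⊕ₗ m ↪o JJ := (inlLex (m ⊕ₗ m) (p ⊕ₗ p)).trans E₁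
  let ιF : p ⊕ₗ p ↪o JJ := (inrLex (m ⊕ₗ m) (p ⊕ₗ p)).trans E₁
  -- how the block/fine embeddings of the three steps factor through `ιC, ιM, ιF`
  have h2C : (inlLex (n ⊕ₗ n) (m ⊕ₗ m)).trans E₂ = ιC := by ext x; rfl
  have h2M : (inrLex (n ⊕ₗ n) (m ⊕ₗ m)).trans E₂ = ιM := by ext x; rfl
  have h3C : (inlLex (n ⊕ₗ n) (p ⊕ₗ p)).trans E₃ = ιC := by ext x; rfl
  have h3F : (inrLex (n ⊕ₗ n) (p ⊕ₗ p)).trans E₃ = ιF := by ext x; rfl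
  have h1M : (inlLex (m ⊕ₗ m) (p ⊕ₗ p)).trans E₁ = ιM := rfl
  have h1F : (inrLex (m ⊕ₗ m) (p ⊕ₗ p)).trans E₁ = ιF := rfl
  -- injectivity of the block embedding
  have hinj : Function.Injective
      (ExteriorAlgebra.map (Function.ExtendByZero.linearMap R ιC)) :=
    map_extendByZero_injective R ιC.injective
  apply hinj
  -- the three transformations in the ambient algebra
  have hT2 := map_extendByZero_fermionBlockRG R E₂ c Q Qb (fermionBlockRG R b Rm Rb ρ)
  have hT1 := map_extendByZero_fermionBlockRG R E₁ b Rm Rb ρ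
  have hT3 := map_extendByZero_fermionBlockRG R E₃ (c * b * Ring.inverse (b + c)) (Q * Rm) (Rb * Qb) ρ
  rw [h2C, h2M] at hT2
  rw [h1M, h1F] at hT1
  rw [h3C, h3F] at hT3
  rw [map_smul, hT2, hT1, hT3, map_extendByZero_blockRGWeight, map_extendByZero_blockRGWeight,
    map_extendByZero_blockRGWeight, h2M, h1F, h3F]
  -- pointwise forms of the factorisations, to normalise the block-field vectors
  have h2C' : ∀ x, E₂ (inlLex (n ⊕ₗ n) (m ⊕ₗ m) x) = ιC x := fun x => rfl
  have h3C' : ∀ x, E₃ (inlLex (n ⊕ₗ n) (p ⊕ₗ p) x) = ιC x := fun x => rfl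
  have hgen : ∀ i, ι R (Pi.single (E₁ (inlLex (m ⊕ₗ m) (p ⊕ₗ p) (toLex (Sum.inl i)))) (1 : R)) =
      psiBarOf R ιM i := fun i => rfl
  have hgen' : ∀ i, ι R (Pi.single (E₁ (inlLex (m ⊕ₗ m) (p ⊕ₗ p) (toLex (Sum.inr i)))) (1 : R)) =
      psiOf R ιM i := fun i => rfl
  simp only [h2C', h3C', hgen, hgen']
  -- order facts in the three-family index type: `χ < ψ < φ`
  have hCM : ∀ (x : n ⊕ₗ n) (k : m ⊕ₗ m), ιC x < ιM k := fun x k => Sum.Lex.inl_lt_inr _ _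
  have hCF : ∀ (x : n ⊕ₗ n) (l : p ⊕ₗ p), ιC x < ιF l := fun x l => Sum.Lex.inl_lt_inr _ _
  have hMF : ∀ (k : m ⊕ₗ m) (l : p ⊕ₗ p), ιM k < ιF l := fun k l =>
    Sum.Lex.inr_lt_inr_iff.2 (Sum.Lex.inl_lt_inr _ _)
  exact berezinOn_blockWeight_mul_berezinOn_blockWeight_mul R ιM ιF (fun k l => ne_of_lt (hMF k l))
    Q Qb hQ hb hbc Rm Rb (fun y => Pi.single (ιC (toLex (Sum.inl y))) 1)
    (fun y => Pi.single (ιC (toLex (Sum.inr y))) 1)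
    (fun y k => Pi.single_eq_of_ne (ne_of_gt (hCM _ k)) _)
    (fun y k => Pi.single_eq_of_ne (ne_of_gt (hCM _ k)) _)
    (fun y l => Pi.single_eq_of_ne (ne_of_gt (hCF _ l)) _)
    (fun y l => Pi.single_eq_of_ne (ne_of_gt (hCF _ l)) _)
    (ExteriorAlgebra.map (Function.ExtendByZero.linearMap R ιF) ρ)
    (map_extendByZero_mem_spectatorSubalgebra R ιF (fun l hl => by
      obtain ⟨k, -, hk⟩ := Finset.mem_map.1 hl
      exact absurd hk (ne_of_lt (hMF k l))) ρ)

end TwoAlgebraComposition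

/-! ### §7 The `k`-fold tower: BOS Lemma II.1 "in iterated form" ∕ Dimock (30) -/

section Tower

variable (R : Type*) [CommRing R] [Algebra ℚ R]
variable (𝓘 : ℕ → Type*) [∀ k, LinearOrder (𝓘 k)] [∀ k, Fintype (𝓘 k)]

/-- **Composite averaging `Q_k`** along a tower of fermion lattices `𝓘 0, 𝓘 1, …`:
`Qacc 0 = 1`, `Qacc (k+1) = Q_k · Qacc k` (BOS: *"`Q_k` is the averaging operator over blocks of side
size `L^kε`"*; Dimock (33)∕(36) `Q_{k+1} = σ_{L}^{-1} Q Q_k σ_L`, here without rescaling). [cite: BalabanOcarrollSchor1989, §I (1.3)] -/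
def Qacc (Qs : (k : ℕ) → Matrix (𝓘 (k + 1)) (𝓘 k) R) : (k : ℕ) → Matrix (𝓘 k) (𝓘 0) R
  | 0 => 1
  | k + 1 => Qs k * Qacc Qs k

/-- Composite conjugate averaging `Q̄_k`: `Qbacc 0 = 1`, `Qbacc (k+1) = Qbacc k · Q̄_k`. [cite: BalabanOcarrollSchor1989, §I (1.3)] -/
def Qbacc (Qbs : (k : ℕ) → Matrix (𝓘 k) (𝓘 (k + 1)) R) : (k : ℕ) → Matrix (𝓘 0) (𝓘 k) R
  | 0 => 1
  | k + 1 => Qbacc Qbs k * Qbs k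

/-- The `k`-fold iterate of the tree's block RG transformation along the tower, with one-step
weights `c k` (BOS: `T^{L^{k-1}ε}_{a,L} ⋯ T^{Lε}_{a,L} T^{ε}_{a,L}`; Dimock (30), left side).
[cite: BalabanOcarrollSchor1989, §II Lemma II.1] -/
def towerT (Qs : (k : ℕ) → Matrix (𝓘 (k + 1)) (𝓘 k) R) (Qbs : (k : ℕ) → Matrix (𝓘 k) (𝓘 (k + 1)) R)
    (c : ℕ → R) (ρ : GrassmannAlgebra R (𝓘 0 ⊕ₗ 𝓘 0)) : (k : ℕ) → GrassmannAlgebra R (𝓘 k ⊕ₗ 𝓘 k)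
  | 0 => ρ
  | k + 1 => fermionBlockRG R (c k) (Qs k) (Qbs k) (towerT Qs Qbs c ρ k)

variable {𝓘}

/-- The accumulated Gaussian weight: `bacc 0 = c 0`, `bacc (k+1) = c_{k+1} bacc_k ∕ (bacc_k + c_{k+1})`,
i.e. `1/bacc_{k+1} = 1/bacc_k + 1/c_{k+1}` (BOS: `1/a_{k+1} = L⁻¹/a_k + 1/a`; Dimock (211):
`b_{k+1} = bb_k/(b_k + bL⁻¹)`). [cite: BalabanOcarrollSchor1989, §II Lemma II.1] -/
def bacc (c : ℕ → R) : ℕ → R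
  | 0 => c 0
  | k + 1 => c (k + 1) * bacc c k * Ring.inverse (bacc c k + c (k + 1))

/-- The accumulated normalisation constant: the product of the one-step constants
`ε_{𝓘(j+1)} det(−(bacc_j·1 + c_{j+1} Q̄_{j+1}Q_{j+1}))` (BOS (1.2): absorbed into `N`).
[cite: BalabanOcarrollSchor1989, §II Lemma II.1] -/
def accConst (Qs : (k : ℕ) → Matrix (𝓘 (k + 1)) (𝓘 k) R) (Qbs : (k : ℕ) → Matrix (𝓘 k) (𝓘 (k + 1)) R)
    (c : ℕ → R) : ℕ → R
  | 0 => 1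
  | k + 1 => accConst Qs Qbs c k *
      ((-1 : R) ^ (Fintype.card (𝓘 (k + 1)) * (Fintype.card (𝓘 (k + 1)) - 1) / 2) *
        (-fluctuationOp (c (k + 1)) (Qs (k + 1)) (Qbs (k + 1))
          (bacc R c k • (1 : Matrix (𝓘 (k + 1)) (𝓘 (k + 1)) R))).det)

omit [Algebra ℚ R] in
/-- **The composite averages again satisfy `Q_kQ̄_k = 1`** (BOS: *"`Q_kQ_k* = I`"* for every `k`).
[cite: BalabanOcarrollSchor1989, §II] -/
theorem Qacc_mul_Qbacc {Qs : (k : ℕ) → Matrix (𝓘 (k + 1)) (𝓘 k) R}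
    {Qbs : (k : ℕ) → Matrix (𝓘 k) (𝓘 (k + 1)) R} (hQ : ∀ k, Qs k * Qbs k = 1) (k : ℕ) :
    Qacc R 𝓘 Qs k * Qbacc R 𝓘 Qbs k = 1 := by
  induction k with
  | zero => simp [Qacc, Qbacc]
  | succ k ih =>
    show Qs k * Qacc R 𝓘 Qs k * (Qbacc R 𝓘 Qbs k * Qbs k) = 1
    rw [Matrix.mul_assoc, ← Matrix.mul_assoc (Qacc R 𝓘 Qs k), ih, Matrix.one_mul, hQ]

/-- **BOS Lemma II.1 in iterated form ∕ Dimock (30) (Gaussian part): `k + 1` block RG steps are ONE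
block RG step** with the composite averages `Qacc (k+1)`, `Qbacc (k+1)`, the accumulated weight
`bacc k` and the accumulated constant: `T_{c_k} ⋯ T_{c_0} ρ = accConst k • T_{bacc k, Qacc(k+1), Qbacc(k+1)} ρ`
for every density `ρ`, provided each one-step pair satisfies `Q_jQ̄_j = 1` and the weights `bacc_j`,
`bacc_j + c_{j+1}` are units (*"or in iterated form … with solution `a_k = a(1 − L⁻¹)/(1 − L⁻ᵏ)`"*;
proof by induction, each step being `fermionBlockRG_fermionBlockRG`). [cite: BalabanOcarrollSchor1989, §II Lemma II.1] -/
theorem towerT_succ {Qs : (k : ℕ) → Matrix (𝓘 (k + 1)) (𝓘 k) R}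
    {Qbs : (k : ℕ) → Matrix (𝓘 k) (𝓘 (k + 1)) R} (hQ : ∀ k, Qs k * Qbs k = 1) {c : ℕ → R}
    (hb : ∀ k, IsUnit (bacc R c k)) (hbc : ∀ k, IsUnit (bacc R c k + c (k + 1)))
    (ρ : GrassmannAlgebra R (𝓘 0 ⊕ₗ 𝓘 0)) (k : ℕ) :
    towerT R 𝓘 Qs Qbs c ρ (k + 1) =
      accConst R Qs Qbs c k • fermionBlockRG R (bacc R c k) (Qacc R 𝓘 Qs (k + 1)) (Qbacc R 𝓘 Qbs (k + 1)) ρ := by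
  induction k with
  | zero =>
    simp only [towerT, accConst, bacc, Qacc, Qbacc, Matrix.mul_one, Matrix.one_mul, one_smul]
  | succ k ih =>
    show fermionBlockRG R (c (k + 1)) (Qs (k + 1)) (Qbs (k + 1)) (towerT R 𝓘 Qs Qbs c ρ (k + 1)) = _
    rw [ih, map_smul, fermionBlockRG_fermionBlockRG R (Qs (k + 1)) (Qbs (k + 1)) (hQ (k + 1)) (hb k) (hbc k),
      smul_smul]
    rfl

end Tower

end FermionBlockRG

end QLatticeAQFT

end Literature.MathematicalPhysics.QuantumLattice
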